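import Literature.Analysis.FluidPDE.TorusWordGagliardoNirenberg
import Literature.Analysis.FluidPDE.TorusWordSpaceTime
import Literature.Analysis.FluidPDE.TorusWordVectorCalculus
import Literature.Analysis.FluidPDE.TorusClassicalHnBalance
import Literature.Analysis.FunctionSpaces.TorusClassicalNSUniqueness
import Literature.Analysis.FluidPDE.ExtremeGrowthVorticityControl
import Mathlib.Analysis.ODE.Gronwall
import HarnessLib

/-!
# The Doering–Gibbon ladder theorem `½ Ḣ_N ≤ −ν H_{N+1} + c_N ‖Du‖_∞ H_N + H_N^{1/2} Φ_N^{1/2}`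
  on the torus, every rung

search for candidate a priori estimates; no regularity claim (cell `pub-nsfunc`, literature seat:
this file types a PUBLISHED a priori inequality, nothing new).

Analysis/FluidPDE proof file (three bookkeeping definitions `ladderNonlinear`, `wordForcing`, `ladderF`;
no named facts), sequel of `TorusWordGagliardoNirenberg` (the calculus inequalities at every order),
`TorusClassicalHnBalance` (the `H^{2n}` balances) and `TorusPalinstrophyLadder` (the rung `N = 2`
with the explicit constant `c₂ = 3`). The **Navier–Stokes ladder theorem** of Doering–Gibbon 1995
(Thm 6.1) controls the seminorms `H_N = ∫ |∇ᴺu|²` ((6.1.2)) of a space-periodic flow; Step 5 of its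
proof is the inequality

  `½ Ḣ_N ≤ −ν H_{N+1} + c_N ‖Du‖_∞ H_N + H_N^{1/2} Φ_N^{1/2}`,  `Φ_N = ∫ |∇ᴺf|²`   (6.2.27)

and Step 6 (Lemma 6.2, `H_N ≤ H_{N−s}^{r/(r+s)} H_{N+r}^{s/(r+s)}`) turns it into
`½ Ḣ_N ≤ −ν H_N^{1+1/s}/H_{N−s}^{1/s} + c_N ‖Du‖_∞ H_N + H_N^{1/2} Φ_N^{1/2}` (6.2.39). This file
proves both at EVERY rung `N`, in every dimension `d`, for classical solutions
`Torus.IsClassicalNSSolutionOn (Icc a b) ν f u p` on the unit torus, with `H_N` rendered as the word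
energy `E_N(u) = ∑_{w : Fin N → d} ∫ ‖∂^w u‖²` (`Torus.wordEnergy`, all ordered words; `= H_N`) and
`‖Du‖_∞` as any pointwise bound `∑ᵢ ‖∂ᵢu(t,x)‖² ≤ M²` (Frobenius norm); the constants `c_N` are
existential in `(card d, N)`:

* `Torus.exists_abs_ladderNonlinear_le` — **the nonlinear term** (6.2.12)–(6.2.25):
  `|∑_{|w|=N} ∫ ⟪∂^w((v·∇)v), ∂^w v⟫| ≤ c_N M E_N(v)` for smooth divergence-free `v` with
  `|Dv| ≤ M` (Leibniz `Torus.wordDeriv_convect_apply`; the transport term vanishes, (6.2.14),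
  tree `Torus.integral_inner_convect_self_right_eq_zero`; Hölder and the Gagliardo–Nirenberg
  inequalities with `a = (l−1)/(N−1)`, `ap = 2`, packaged as the two-function bilinear bound
  `Torus.exists_integral_wordGradSq_mul_le_two`, `∫ |∇ᵏf₁|²|∇ᵐ⁻ᵏf₂|² ≤ C A² (E_m f₁ + E_m f₂)` for
  `‖f₁‖, ‖f₂‖ ≤ A`, applied to `f₁ = ∂ₐv`, `f₂ = ∂ⱼv`);
* `Torus.IsClassicalNSSolutionOn.hasDerivWithinAt_half_integral_norm_sq_wordDeriv`,
  `….hasDerivWithinAt_half_wordEnergy` — **the balance** (6.2.8)/(6.2.11):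
  `d/dt ½ E_N(u) = −ν E_{N+1}(u) − NL_N(u) + ∑_{|w|=N} ∫ ⟪∂^w f, ∂^w u⟫` within `[a, b]`
  (differentiate under the integral, commute `∂ₜ`, `Δ`, `∇` with `∂^w`, the pressure pairs to zero
  with the divergence-free `∂^w u`);
* `Torus.exists_ladder_inequality` — **(6.2.27) at every rung**; `Torus.exists_wordEnergy_le_exp` —
  its Grönwall form without forcing, `E_N(u(t)) ≤ E_N(u(a)) e^{2 c_N M (t−a)}` under `|Du| ≤ M` on
  `[a, b]`; `Torus.exists_wordEnergy_le_mul_exp_integral` — the same against a continuous majorant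
  `|Du(s)| ≤ M(s)`: `E_N(u(t)) ≤ E_N(u(a)) exp(2 c_N ∫ₐᵗ M)` (Majda–Bertozzi (3.79) rung by rung; the
  rung `N = 2` with `2c₂ = 6` is `TorusPalinstrophyGronwall`);
* `Torus.wordEnergy_succ_sq_le`, `Torus.wordEnergy_pow_le_pow_mul_pow` — **Lemma 6.2**:
  `E_{n+1}² ≤ E_n E_{n+2}` ((6.2.31), one integration by parts, Cauchy–Schwarz and
  `‖ΔU‖₂ = ‖∇²U‖₂`) and `E_N^{r+s} ≤ E_{N−s}^r E_{N+r}^s` (discrete log-convexity,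
  `Torus.pow_le_pow_mul_pow_of_sq_le`);
* `Torus.exists_ladder_inequality_rpow` — **(6.2.39)**, `1 ≤ s ≤ N`, at times with `E_{N−s}(u) > 0`;
* `Torus.ladderF`, `Torus.ladderF_pow_le_pow_mul_pow`, `Torus.exists_ladderF_inequality`,
  `Torus.exists_ladderF_inequality_rpow` — **Thm 6.1 as stated** for `F_N = H_N + τ²Φ_N` ((6.2.3),
  `τ = L²ν⁻¹ = ν⁻¹` on the unit torus) under a TIME-INDEPENDENT forcing with a spectral cutoff
  `Φ_{N+1} ≤ Λ Φ_N` (`Λ = λ_f⁻²`, (6.2.2); `λ₀⁻² = Λ + 1`, (6.2.4)): Lemma 6.3 (6.2.46), the two-sided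
  (6.2.43)/(6.2.6) `|½Ḟ_N + νF_{N+1}| ≤ (c_N‖Du‖_∞ + νλ₀⁻²)F_N` (Steps 7, 9) and (6.2.5)
  `½Ḟ_N ≤ −νF_N^{1+1/s}/F_{N−s}^{1/s} + (c_N‖Du‖_∞ + νλ₀⁻²)F_N` (Step 8);
* `Torus.exists_log_ladderF_add_integral_wavenumber_le` — **Thm 6.2 over a finite window**
  ((6.4.1) integrated on `[a, b]`; the printed (6.4.3) is its long-time average): for a forcing
  nondegenerate at rung `N` (`Φ_N > 0`, cf. (6.4.2)) and a continuous majorant `|Du(τ)| ≤ M(τ)`,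
  `(2ν)⁻¹ log(F_N(b)/F_N(a)) + ∫ₐᵇ κ²_{N,N−s} ≤ c_N ν⁻¹ ∫ₐᵇ M + λ₀⁻²(b − a)`,
  `κ²_{N,r} = (F_N/F_r)^{1/(N−r)}` (Def. 6.1).

Faithfulness: Doering–Gibbon work on `[0, L]^d`, `d = 2, 3`, with `H_N` written through `curlᴺ`, and
take the cutoff (6.2.2) as a `sup` over all `N`; proved here on the unit torus (`L = 1`), any `d`,
inexplicit `c_N`, with the cutoff assumed at the rung `N` in hand only; (6.2.27)/(6.2.39) for arbitrary
smooth time-dependent forcing, the `F_N` statements for time-independent forcing as printed.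
-- TODO(general form): box length `L` (the `UnitAddTorus` API is at `L = 1`) and explicit `c_N`.

## Mathlib / tree search

Tree (reused): `TorusWordGagliardoNirenberg` (`exists_gnMoment_le`, `exists_integral_wordGradSq_mul_le`,
`pow_le_pow_mul_pow_of_sq_le`, `wordGradSq`), `TorusWordEnergy`/`TorusWordLeibniz`/`TorusWordL2Bounds`/
`TorusWordSpaceTime`/`TorusWordVectorCalculus` (`wordEnergy_succ'`, `lowerSplits`, `lowCommS`,
`timeDerivWithin_wordDeriv_comm`, `wordDeriv_gradient_comm`, `wordDeriv_divergence_comm`),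
`TorusClassicalHnBalance` (`integral_inner_laplacian_self_eq_neg_gradNormSq`, the template of the
balance), `TorusClassicalNSUniqueness` (`integral_inner_convect_self_right_eq_zero`), `TorusCalculusProofs`
(`integral_inner_gradient_eq_zero_of_isDivFree`, `laplacian_eq_sum_partialDeriv_partialDeriv`,
`fderiv_apply_eq_sum_partialDeriv`), `TorusFluidGlueProofs` (`integral_inner_partialDeriv_eq_neg`),
`TorusEnstrophyOrthogonality` (`partialDeriv_comm`), `ExtremeGrowthVorticityControl`
(`le_mul_exp_integral_of_hasDerivWithinAt_le_mul`, one-sided Grönwall). Existing rungs: `TorusPalinstrophyLadder` (`N = 2`,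
`c₂ = 3`, `f = 0`), `TorusClassicalH1Balance`/`TorusClassicalH3Balance` (flux forms with `H³` on the
right); searched `ladder`, `wordEnergy` with `hasDerivWithinAt`, `Gronwall` + `wordEnergy`: no
every-rung statement. Mathlib: `Real.sum_mul_le_sqrt_mul_sqrt`, `le_gronwallBound_of_liminf_deriv_right_le`,
`HasDerivWithinAt.liminf_right_slope_le`, `Real.rpow_le_rpow`.

## References

* C. R. Doering, J. D. Gibbon, *Applied Analysis of the Navier–Stokes Equations*, CUP 1995, §6.2,
  Thm 6.1 and its proof: (6.2.8)–(6.2.14) (balance, Laplacian term, transport), Lemma 6.1 and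
  (6.2.15)–(6.2.25) (nonlinear term), (6.2.26)–(6.2.27) (forcing, Step 5), Lemma 6.2
  (6.2.28)–(6.2.38), (6.2.39), Steps 7–9 (6.2.40)–(6.2.48) with Lemma 6.3, the statement
  (6.2.2)–(6.2.6); §6.3 Def. 6.1 (6.3.8) and §6.4 (6.4.1)–(6.4.3), Thm 6.2 (held:
  `book:doering1995-applied-analysis-navier-stokes-equations`, chunks p0099–p0105). [DoeringGibbon1995]
* A. J. Majda, A. L. Bertozzi, *Vorticity and Incompressible Flow*, CUP 2002, §3.2 Prop. 3.7,
  §3.3 proof of Thm 3.6, eq. (3.79) (`‖v(T)‖_m ≤ ‖v₀‖_m exp(∫₀ᵀ c_m|∇v|_{L^∞})`), and §3.5.1 (the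
  `H^m` energy method with the same calculus inequalities). [MajdaBertozziCUP2002]
-/

noncomputable section

open MeasureTheory Set Function
open scoped ContDiff InnerProductSpace RealInnerProductSpace

namespace Literature.Analysis.FluidPDE

namespace Torus

open FunctionSpaces FunctionSpaces.Torus

variable {d : Type*} [Fintype d] [DecidableEq d] {F' : Type*} [NormedAddCommGroup F'] [InnerProductSpace ℝ F']

/-! ## Bookkeeping: word energies, Cauchy–Schwarz -/

/-- List form of `norm_sq_wordDeriv_le_wordGradSq`: `‖∂^w f(x)‖² ≤ |∇ⁿf(x)|²`, `n = |w|`.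
[cite: DoeringGibbon1995, §6.1 (6.1.2)] (bookkeeping) -/
theorem norm_sq_wordDeriv_list_le_wordGradSq (w : List d) (f : UnitAddTorus d → F') (x : UnitAddTorus d) :
    ‖wordDeriv w f x‖ ^ 2 ≤ wordGradSq w.length f x := by
  have h := norm_sq_wordDeriv_le_wordGradSq (fun i : Fin w.length => w.get i) f x
  rwa [List.ofFn_get] at h

/-- Inner letter: `E_n(∂ₐf) ≤ E_{n+1}(f)`. [cite: DoeringGibbon1995, §6.1 (6.1.2)] (bookkeeping) -/
theorem wordEnergy_partialDeriv_le {f : UnitAddTorus d → F'} (hf : IsSmooth f) (n : ℕ) (a : d) :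
    wordEnergy n (Torus.partialDeriv a f) ≤ wordEnergy (n + 1) f := by
  rw [wordEnergy_succ']
  unfold wordEnergy
  refine Finset.sum_le_sum fun u _ => ?_
  rw [wordDeriv_partialDeriv_comm hf a]
  exact Finset.single_le_sum (f := fun i => ∫ x, ‖Torus.partialDeriv i (wordDeriv (List.ofFn u) f) x‖ ^ 2)
    (fun _ _ => integral_nonneg fun _ => sq_nonneg _) (Finset.mem_univ a)

omit [DecidableEq d] in
/-- Cauchy–Schwarz on the torus for continuous functions: `∫ φ ψ ≤ √(∫ φ²) √(∫ ψ²)`, `φ, ψ ≥ 0`.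
[cite: DoeringGibbon1995, Appendix A (A.0.12)] -/
theorem integral_mul_le_sqrt_mul_sqrt' {φ ψ : UnitAddTorus d → ℝ} (hφ : Continuous φ) (hψ : Continuous ψ)
    (hφ0 : ∀ x, 0 ≤ φ x) (hψ0 : ∀ x, 0 ≤ ψ x) :
    ∫ x, φ x * ψ x ≤ Real.sqrt (∫ x, φ x ^ 2) * Real.sqrt (∫ x, ψ x ^ 2) := by
  have h := integral_mul_le_of_continuous hφ hψ hφ0 hψ0 Real.HolderConjugate.two_two
  simp_rw [Real.rpow_two] at h
  rw [Real.sqrt_eq_rpow, Real.sqrt_eq_rpow]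
  exact h

omit [DecidableEq d] in
/-- Cauchy–Schwarz for the `L²` pairing of smooth fields: `|∫ ⟪F, G⟫| ≤ (∫ ‖F‖²)^{1/2} (∫ ‖G‖²)^{1/2}`.
[cite: DoeringGibbon1995, Appendix A (A.0.12)] -/
theorem abs_integral_inner_le_sqrt_mul_sqrt_of_isSmooth {F G : UnitAddTorus d → F'} (hF : IsSmooth F)
    (hG : IsSmooth G) :
    |∫ x, ⟪F x, G x⟫| ≤ Real.sqrt (∫ x, ‖F x‖ ^ 2) * Real.sqrt (∫ x, ‖G x‖ ^ 2) := by
  calc |∫ x, ⟪F x, G x⟫| ≤ ∫ x, |⟪F x, G x⟫| := abs_integral_le_integral_abs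
    _ ≤ ∫ x, ‖F x‖ * ‖G x‖ :=
        integral_mono_of_nonneg (ae_of_all _ fun x => abs_nonneg _)
          ((hF.continuous.norm.mul hG.continuous.norm).integrable_unitAddTorus)
          (ae_of_all _ fun x => abs_real_inner_le_norm _ _)
    _ ≤ Real.sqrt (∫ x, ‖F x‖ ^ 2) * Real.sqrt (∫ x, ‖G x‖ ^ 2) :=
        integral_mul_le_sqrt_mul_sqrt' hF.continuous.norm hG.continuous.norm (fun _ => norm_nonneg _)
          fun _ => norm_nonneg _

/-! ## The nonlinear term -/

/-- **Bilinear Gagliardo–Nirenberg bound for two functions with a common sup bound**: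
`∫ |∇ᵏf₁|² |∇ᵐ⁻ᵏf₂|² ≤ C A² (E_m(f₁) + E_m(f₂))` for smooth `f₁, f₂` with `‖f₁‖, ‖f₂‖ ≤ A`,
`0 ≤ k ≤ m` (Hölder `(m/k, m/(m−k))`, the power form `exists_gnMoment_le` for each function,
and the weighted AM–GM inequality). The shape of Doering–Gibbon (6.2.15)–(6.2.25) with `f₁ = ∂ₐu`,
`f₂ = ∂ⱼu`. [cite: DoeringGibbon1995, §6.2 (6.2.15)–(6.2.25); Appendix A (A.0.19)–(A.0.21)]
(every order, any dimension; ours as bookkeeping) -/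
theorem exists_integral_wordGradSq_mul_le_two (d : Type*) [Fintype d] [DecidableEq d] (F' : Type*)
    [NormedAddCommGroup F'] [InnerProductSpace ℝ F'] {m k : ℕ} (hkm : k ≤ m) :
    ∃ C : ℝ, 0 ≤ C ∧ ∀ (f₁ f₂ : UnitAddTorus d → F'), IsSmooth f₁ → IsSmooth f₂ → ∀ A : ℝ,
      (∀ x, ‖f₁ x‖ ≤ A) → (∀ x, ‖f₂ x‖ ≤ A) →
        ∫ x, wordGradSq k f₁ x * wordGradSq (m - k) f₂ x ≤ C * A ^ 2 * (wordEnergy m f₁ + wordEnergy m f₂) := by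
  -- the endpoint `k = 0`
  have hend : ∀ (n : ℕ) (f₁ f₂ : UnitAddTorus d → F'), IsSmooth f₁ → IsSmooth f₂ → ∀ A : ℝ, (∀ x, ‖f₁ x‖ ≤ A) →
      ∫ x, wordGradSq 0 f₁ x * wordGradSq n f₂ x ≤ A ^ 2 * wordEnergy n f₂ := by
    intro n f₁ f₂ hf₁ hf₂ A hA
    rw [← integral_wordGradSq hf₂ n, ← integral_const_mul]
    refine integral_mono (((continuous_wordGradSq hf₁ 0).mul (continuous_wordGradSq hf₂ n)).integrable_unitAddTorus)
      (((continuous_wordGradSq hf₂ n).const_mul _).integrable_unitAddTorus) fun x => ?_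
    show wordGradSq 0 f₁ x * wordGradSq n f₂ x ≤ A ^ 2 * wordGradSq n f₂ x
    rw [wordGradSq_zero]
    exact mul_le_mul_of_nonneg_right (pow_le_pow_left₀ (norm_nonneg _) (hA x) 2) (wordGradSq_nonneg _ _ _)
  rcases Nat.eq_zero_or_pos k with hk0 | hk0
  · subst hk0
    refine ⟨1, zero_le_one, fun f₁ f₂ hf₁ hf₂ A hA₁ hA₂ => ?_⟩
    have h := hend m f₁ f₂ hf₁ hf₂ A hA₁
    have : 0 ≤ A ^ 2 * wordEnergy m f₁ := mul_nonneg (sq_nonneg _) (wordEnergy_nonneg _ _)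
    simp only [Nat.sub_zero, one_mul]; linarith
  rcases hkm.eq_or_lt with hkm' | hkm'
  · subst hkm'
    refine ⟨1, zero_le_one, fun f₁ f₂ hf₁ hf₂ A hA₁ hA₂ => ?_⟩
    have h := hend k f₂ f₁ hf₂ hf₁ A hA₂
    have : 0 ≤ A ^ 2 * wordEnergy k f₂ := mul_nonneg (sq_nonneg _) (wordEnergy_nonneg _ _)
    simp only [Nat.sub_self, one_mul]
    calc ∫ x, wordGradSq k f₁ x * wordGradSq 0 f₂ x = ∫ x, wordGradSq 0 f₂ x * wordGradSq k f₁ x := by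
          simp_rw [mul_comm]
      _ ≤ A ^ 2 * (wordEnergy k f₁ + wordEnergy k f₂) := by linarith
  -- interior case
  obtain ⟨C₁, hC₁0, hC₁⟩ := exists_gnMoment_le d F' (m := m) (j := k) hk0 hkm
  obtain ⟨C₂, hC₂0, hC₂⟩ := exists_gnMoment_le d F' (m := m) (j := m - k) (by omega) (by omega)
  have hm0 : (0 : ℝ) < m := by exact_mod_cast (show 0 < m by omega)
  have hk0' : (0 : ℝ) < k := by exact_mod_cast hk0
  have hmk0 : (0 : ℝ) < (m : ℝ) - k := by
    have : (k : ℝ) < m := by exact_mod_cast hkm'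
    linarith
  refine ⟨C₁ ^ ((k : ℝ) / m) * C₂ ^ (((m : ℝ) - k) / m), by positivity, fun f₁ f₂ hf₁ hf₂ A hA₁ hA₂ => ?_⟩
  have hA0 : 0 ≤ A := (norm_nonneg _).trans (hA₁ 0)
  have hE₁ : 0 ≤ wordEnergy m f₁ := wordEnergy_nonneg _ _
  have hE₂ : 0 ≤ wordEnergy m f₂ := wordEnergy_nonneg _ _
  have hαβ : ((m : ℝ) / k).HolderConjugate ((m : ℝ) / ((m : ℝ) - k)) := by
    rw [Real.holderConjugate_iff]
    refine ⟨by rw [lt_div_iff₀ hk0']; linarith, ?_⟩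
    field_simp; ring
  have hH := integral_mul_le_of_continuous (continuous_wordGradSq hf₁ k) (continuous_wordGradSq hf₂ (m - k))
    (wordGradSq_nonneg k f₁) (wordGradSq_nonneg (m - k) f₂) hαβ
  have hmk : (((m - k : ℕ) : ℝ)) = (m : ℝ) - k := Nat.cast_sub hkm
  have h1 : (∫ x, wordGradSq k f₁ x ^ ((m : ℝ) / k)) ^ (1 / ((m : ℝ) / k)) ≤
      (C₁ * A ^ (2 * ((m : ℝ) - k) / k) * wordEnergy m f₁) ^ ((k : ℝ) / m) := by
    rw [one_div_div]
    exact Real.rpow_le_rpow (gnMoment_nonneg m k f₁) (hC₁ f₁ hf₁ A hA₁) (by positivity)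
  have h2 : (∫ x, wordGradSq (m - k) f₂ x ^ ((m : ℝ) / ((m : ℝ) - k))) ^ (1 / ((m : ℝ) / ((m : ℝ) - k))) ≤
      (C₂ * A ^ (2 * ((m : ℝ) - ((m : ℝ) - k)) / ((m : ℝ) - k)) * wordEnergy m f₂) ^ (((m : ℝ) - k) / m) := by
    rw [one_div_div]
    have := hC₂ f₂ hf₂ A hA₂
    unfold gnMoment at this
    rw [hmk] at this
    exact Real.rpow_le_rpow (integral_nonneg fun x => Real.rpow_nonneg (wordGradSq_nonneg _ _ _) _) this
      (by positivity)
  refine hH.trans ((mul_le_mul h1 h2 (Real.rpow_nonneg (integral_nonneg fun x =>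
    Real.rpow_nonneg (wordGradSq_nonneg _ _ _) _) _) (by positivity)).trans ?_)
  rw [Real.mul_rpow (by positivity) hE₁, Real.mul_rpow hC₁0 (by positivity),
    Real.mul_rpow (by positivity) hE₂, Real.mul_rpow hC₂0 (by positivity),
    ← Real.rpow_mul hA0, ← Real.rpow_mul hA0]
  have eA : A ^ (2 * ((m : ℝ) - k) / k * ((k : ℝ) / m)) * A ^ (2 * ((m : ℝ) - ((m : ℝ) - k)) / ((m : ℝ) - k) * (((m : ℝ) - k) / m))
      = A ^ 2 := by
    rw [← Real.rpow_add' hA0 (by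
      rw [show 2 * ((m : ℝ) - k) / k * ((k : ℝ) / m) + 2 * ((m : ℝ) - ((m : ℝ) - k)) / ((m : ℝ) - k) * (((m : ℝ) - k) / m) = 2 by
        field_simp; ring]; norm_num)]
    rw [show 2 * ((m : ℝ) - k) / k * ((k : ℝ) / m) + 2 * ((m : ℝ) - ((m : ℝ) - k)) / ((m : ℝ) - k) * (((m : ℝ) - k) / m) = 2 by
      field_simp; ring]
    norm_cast
  -- weighted AM–GM on the energies
  have hYoung : wordEnergy m f₁ ^ ((k : ℝ) / m) * wordEnergy m f₂ ^ (((m : ℝ) - k) / m) ≤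
      wordEnergy m f₁ + wordEnergy m f₂ := by
    have hw : (k : ℝ) / m + ((m : ℝ) - k) / m = 1 := by field_simp; ring
    have h := Real.geom_mean_le_arith_mean2_weighted (by positivity) (by positivity) hE₁ hE₂ hw
    have h3 : (k : ℝ) / m * wordEnergy m f₁ + ((m : ℝ) - k) / m * wordEnergy m f₂ ≤ wordEnergy m f₁ + wordEnergy m f₂ := by
      have a1 : (k : ℝ) / m ≤ 1 := by rw [div_le_one hm0]; exact_mod_cast hkm
      have a2 : ((m : ℝ) - k) / m ≤ 1 := by rw [div_le_one hm0]; linarith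
      nlinarith
    exact h.trans h3
  calc C₁ ^ ((k : ℝ) / m) * A ^ (2 * ((m : ℝ) - k) / k * ((k : ℝ) / m)) * wordEnergy m f₁ ^ ((k : ℝ) / m) *
        (C₂ ^ (((m : ℝ) - k) / m) * A ^ (2 * ((m : ℝ) - ((m : ℝ) - k)) / ((m : ℝ) - k) * (((m : ℝ) - k) / m)) *
          wordEnergy m f₂ ^ (((m : ℝ) - k) / m))
      = C₁ ^ ((k : ℝ) / m) * C₂ ^ (((m : ℝ) - k) / m) *
          (A ^ (2 * ((m : ℝ) - k) / k * ((k : ℝ) / m)) * A ^ (2 * ((m : ℝ) - ((m : ℝ) - k)) / ((m : ℝ) - k) * (((m : ℝ) - k) / m))) *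
          (wordEnergy m f₁ ^ ((k : ℝ) / m) * wordEnergy m f₂ ^ (((m : ℝ) - k) / m)) := by ring
    _ ≤ C₁ ^ ((k : ℝ) / m) * C₂ ^ (((m : ℝ) - k) / m) * A ^ 2 * (wordEnergy m f₁ + wordEnergy m f₂) := by
        rw [eA]
        exact mul_le_mul_of_nonneg_left hYoung (by positivity)


/-- A uniform constant over `k ≤ m` for the two-function bilinear bound. [folklore] -/
private theorem exists_uniform_bilinear (d : Type*) [Fintype d] [DecidableEq d] (F' : Type*)
    [NormedAddCommGroup F'] [InnerProductSpace ℝ F'] (m : ℕ) :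
    ∃ C : ℝ, 0 ≤ C ∧ ∀ k, k ≤ m → ∀ (f₁ f₂ : UnitAddTorus d → F'), IsSmooth f₁ → IsSmooth f₂ → ∀ A : ℝ,
      (∀ x, ‖f₁ x‖ ≤ A) → (∀ x, ‖f₂ x‖ ≤ A) →
        ∫ x, wordGradSq k f₁ x * wordGradSq (m - k) f₂ x ≤ C * A ^ 2 * (wordEnergy m f₁ + wordEnergy m f₂) := by
  classical
  -- choose a constant for every `k ≤ m` and add them up
  set c : ℕ → ℝ := fun k => if hk : k ≤ m then Classical.choose (exists_integral_wordGradSq_mul_le_two d F' hk) else 0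
    with hc
  have hc0 : ∀ k, 0 ≤ c k := fun k => by
    simp only [hc]; split_ifs with hk
    · exact (Classical.choose_spec (exists_integral_wordGradSq_mul_le_two d F' hk)).1
    · exact le_rfl
  refine ⟨∑ k ∈ Finset.range (m + 1), c k, Finset.sum_nonneg fun k _ => hc0 k, ?_⟩
  intro k hk f₁ f₂ hf₁ hf₂ A hA₁ hA₂
  have hspec := (Classical.choose_spec (exists_integral_wordGradSq_mul_le_two d F' hk)).2 f₁ f₂ hf₁ hf₂ A hA₁ hA₂
  have hck : Classical.choose (exists_integral_wordGradSq_mul_le_two d F' hk) = c k := by simp only [hc, dif_pos hk]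
  rw [hck] at hspec
  refine hspec.trans (mul_le_mul_of_nonneg_right (mul_le_mul_of_nonneg_right ?_ (sq_nonneg A))
    (add_nonneg (wordEnergy_nonneg _ _) (wordEnergy_nonneg _ _)))
  exact Finset.single_le_sum (f := c) (fun k _ => hc0 k) (Finset.mem_range.2 (Nat.lt_succ_of_le hk))

variable {v : UnitAddTorus d → EuclideanSpace ℝ d}

/-- The sup bound on the full gradient bounds every first derivative: `‖∂ₐv(x)‖ ≤ M`. [folklore] -/
private theorem norm_partialDeriv_le_of_gradBound {M : ℝ} (hM0 : 0 ≤ M)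
    (hM : ∀ x, ∑ i, ‖Torus.partialDeriv i v x‖ ^ 2 ≤ M ^ 2) (a : d) (x : UnitAddTorus d) :
    ‖Torus.partialDeriv a v x‖ ≤ M := by
  have h1 : ‖Torus.partialDeriv a v x‖ ^ 2 ≤ M ^ 2 :=
    (Finset.single_le_sum (f := fun i => ‖Torus.partialDeriv i v x‖ ^ 2) (fun _ _ => sq_nonneg _)
      (Finset.mem_univ a)).trans (hM x)
  exact (pow_le_pow_iff_left₀ (norm_nonneg _) hM0 two_ne_zero).1 h1

/-- **The per-term `L²` bound** behind Doering–Gibbon (6.2.16)–(6.2.25): for words `α ≠ []`, `β` with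
`|α| + |β| = N` and a smooth `v` with `|∇v| ≤ M`,
`∫ ‖∂^α v‖² ‖∂^β ∂ⱼv‖² ≤ 2 C M² E_N(v)` (`∂^α v = ∂^{α'}∂ₐv`, the bilinear Gagliardo–Nirenberg bound
for the pair `∂ₐv, ∂ⱼv` at order `N − 1`, and `E_{N−1}(∂ₐv) ≤ E_N(v)`).
[cite: DoeringGibbon1995, §6.2 (6.2.16)–(6.2.25)] (every order; ours as bookkeeping) -/
theorem integral_normSq_wordDeriv_mul_le (hv : IsSmooth v) {M : ℝ} (hM0 : 0 ≤ M)
    (hM : ∀ x, ∑ i, ‖Torus.partialDeriv i v x‖ ^ 2 ≤ M ^ 2) {N : ℕ} {C : ℝ} (hC0 : 0 ≤ C)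
    (hC : ∀ k, k ≤ N - 1 → ∀ (f₁ f₂ : UnitAddTorus d → EuclideanSpace ℝ d), IsSmooth f₁ → IsSmooth f₂ → ∀ A : ℝ,
      (∀ x, ‖f₁ x‖ ≤ A) → (∀ x, ‖f₂ x‖ ≤ A) →
        ∫ x, wordGradSq k f₁ x * wordGradSq (N - 1 - k) f₂ x ≤ C * A ^ 2 * (wordEnergy (N - 1) f₁ + wordEnergy (N - 1) f₂))
    {α β : List d} (hα : α ≠ []) (hαβ : α.length + β.length = N) (j : d) :
    ∫ x, ‖wordDeriv α v x‖ ^ 2 * ‖wordDeriv β (Torus.partialDeriv j v) x‖ ^ 2 ≤ 2 * C * M ^ 2 * wordEnergy N v := by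
  obtain ⟨α', a, rfl⟩ : ∃ α' a, α = α' ++ [a] := by
    rcases α.eq_nil_or_concat' with h | ⟨L, b, h⟩
    · exact absurd h hα
    · exact ⟨L, b, h⟩
  rw [List.length_append, List.length_singleton] at hαβ
  have hN : 1 ≤ N := by omega
  have hk : α'.length ≤ N - 1 := by omega
  have hβ : β.length = N - 1 - α'.length := by omega
  have hva : IsSmooth (Torus.partialDeriv a v) := hv.partialDeriv a
  have hvj : IsSmooth (Torus.partialDeriv j v) := hv.partialDeriv j
  have h1 := hC α'.length hk _ _ hva hvj M (norm_partialDeriv_le_of_gradBound hM0 hM a)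
    (norm_partialDeriv_le_of_gradBound hM0 hM j)
  have h2 : ∫ x, ‖wordDeriv (α' ++ [a]) v x‖ ^ 2 * ‖wordDeriv β (Torus.partialDeriv j v) x‖ ^ 2 ≤
      ∫ x, wordGradSq α'.length (Torus.partialDeriv a v) x * wordGradSq (N - 1 - α'.length) (Torus.partialDeriv j v) x := by
    refine integral_mono ?_ (((continuous_wordGradSq hva _).mul (continuous_wordGradSq hvj _)).integrable_unitAddTorus)
      fun x => ?_
    · exact ((((isSmooth_wordDeriv hv _).continuous.norm).pow 2).mul
        (((isSmooth_wordDeriv hvj _).continuous.norm).pow 2)).integrable_unitAddTorus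
    · have e1 : wordDeriv (α' ++ [a]) v = wordDeriv α' (Torus.partialDeriv a v) := by
        rw [wordDeriv_append]; rfl
      rw [e1, ← hβ]
      exact mul_le_mul (norm_sq_wordDeriv_list_le_wordGradSq _ _ x) (norm_sq_wordDeriv_list_le_wordGradSq _ _ x)
        (sq_nonneg _) (wordGradSq_nonneg _ _ _)
  have h3 : wordEnergy (N - 1) (Torus.partialDeriv a v) + wordEnergy (N - 1) (Torus.partialDeriv j v) ≤ 2 * wordEnergy N v := by
    have ea := wordEnergy_partialDeriv_le hv (N - 1) a
    have ej := wordEnergy_partialDeriv_le hv (N - 1) j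
    rw [Nat.sub_add_cancel hN] at ea ej
    linarith
  have hCM : 0 ≤ C * M ^ 2 := mul_nonneg hC0 (sq_nonneg M)
  calc ∫ x, ‖wordDeriv (α' ++ [a]) v x‖ ^ 2 * ‖wordDeriv β (Torus.partialDeriv j v) x‖ ^ 2
      ≤ C * M ^ 2 * (wordEnergy (N - 1) (Torus.partialDeriv a v) + wordEnergy (N - 1) (Torus.partialDeriv j v)) :=
        h2.trans h1
    _ ≤ C * M ^ 2 * (2 * wordEnergy N v) := mul_le_mul_of_nonneg_left h3 hCM
    _ = 2 * C * M ^ 2 * wordEnergy N v := by ring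


/-- **Leibniz decomposition of `∂^w((v·∇)v)`**: the top term is the transport `(v·∇)∂^w v`, the
rest is the sum over `j` of the lower commutators `∑_{(α,β), α ≠ []} ∂^α v_j • ∂^β ∂ⱼ v`
(Doering–Gibbon (6.2.13)). [cite: DoeringGibbon1995, §6.2 (6.2.13)] -/
theorem wordDeriv_convect_apply (hv : IsSmooth v) (w : List d) (x : UnitAddTorus d) :
    wordDeriv w (Torus.convect v v) x =
      Torus.convect v (wordDeriv w v) x + ∑ j, lowCommS w (fun y => v y j) (Torus.partialDeriv j v) x := by
  have h1 : IsContDiff 1 v := hv.isContDiff (by simp)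
  have e : Torus.convect v v = fun y => ∑ j, (fun z => v z j) y • Torus.partialDeriv j v y := by
    funext y
    exact fderiv_apply_eq_sum_partialDeriv h1 y (v y)
  rw [e, wordDeriv_fun_finset_sum Finset.univ fun j _ => (hv.apply j).smul' (hv.partialDeriv j)]
  simp only
  rw [Finset.sum_congr rfl fun j _ => wordDeriv_smul_eq_top_add_lowCommS (hv.apply j) (hv.partialDeriv j) w x,
    Finset.sum_add_distrib]
  congr 1
  rw [Torus.convect, fderiv_apply_eq_sum_partialDeriv ((isSmooth_wordDeriv hv w).isContDiff (by simp)) x (v x)]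
  refine Finset.sum_congr rfl fun j _ => ?_
  rw [wordDeriv_partialDeriv_comm hv j w]

omit [Fintype d] in
/-- A lower commutator unpacked as a finite sum over `Fin (lowerSplits w).length`. [folklore] -/
private theorem lowCommS_eq_sum_fin {F : Type*} [NormedAddCommGroup F] [NormedSpace ℝ F] (w : List d)
    (a : UnitAddTorus d → ℝ) (U : UnitAddTorus d → F) (x : UnitAddTorus d) :
    lowCommS w a U x = ∑ k : Fin (lowerSplits w).length,
      wordDeriv ((lowerSplits w).get k).1 a x • wordDeriv ((lowerSplits w).get k).2 U x := by
  unfold lowCommS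
  rw [list_map_sum_eq_sum_fin, Finset.sum_apply]

/-- **The per-term pairing bound**: for `α ≠ []`, `|α| + |β| = N`, `|w| = N`,
`|∫ ⟪∂^α v_j • ∂^β ∂ⱼv, ∂^w v⟫| ≤ √(2C) M E_N(v)`. [cite: DoeringGibbon1995, §6.2 (6.2.15)–(6.2.25)]
(every order; ours as bookkeeping) -/
theorem abs_integral_inner_term_le (hv : IsSmooth v) {M : ℝ} (hM0 : 0 ≤ M)
    (hM : ∀ x, ∑ i, ‖Torus.partialDeriv i v x‖ ^ 2 ≤ M ^ 2) {N : ℕ} {C : ℝ} (hC0 : 0 ≤ C)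
    (hC : ∀ k, k ≤ N - 1 → ∀ (f₁ f₂ : UnitAddTorus d → EuclideanSpace ℝ d), IsSmooth f₁ → IsSmooth f₂ → ∀ A : ℝ,
      (∀ x, ‖f₁ x‖ ≤ A) → (∀ x, ‖f₂ x‖ ≤ A) →
        ∫ x, wordGradSq k f₁ x * wordGradSq (N - 1 - k) f₂ x ≤ C * A ^ 2 * (wordEnergy (N - 1) f₁ + wordEnergy (N - 1) f₂))
    {α β w : List d} (hα : α ≠ []) (hαβ : α.length + β.length = N) (hw : w.length = N) (j : d) :
    |∫ x, ⟪wordDeriv α (fun y => v y j) x • wordDeriv β (Torus.partialDeriv j v) x, wordDeriv w v x⟫| ≤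
      Real.sqrt (2 * C) * M * wordEnergy N v := by
  set φ : UnitAddTorus d → ℝ := fun x => |wordDeriv α (fun y => v y j) x| * ‖wordDeriv β (Torus.partialDeriv j v) x‖
    with hφ_def
  set ψ : UnitAddTorus d → ℝ := fun x => ‖wordDeriv w v x‖ with hψ_def
  have hvj : IsSmooth (fun y => v y j) := hv.apply j
  have hα_s : IsSmooth (wordDeriv α (fun y => v y j)) := isSmooth_wordDeriv hvj α
  have hβ_s : IsSmooth (wordDeriv β (Torus.partialDeriv j v)) := isSmooth_wordDeriv (hv.partialDeriv j) β
  have hw_s : IsSmooth (wordDeriv w v) := isSmooth_wordDeriv hv w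
  have hφc : Continuous φ := (continuous_abs.comp hα_s.continuous).mul hβ_s.continuous.norm
  have hψc : Continuous ψ := hw_s.continuous.norm
  -- `|∫ ⟪φ • U, W⟫| ≤ ∫ φ ψ`
  have h1 : |∫ x, ⟪wordDeriv α (fun y => v y j) x • wordDeriv β (Torus.partialDeriv j v) x, wordDeriv w v x⟫| ≤
      ∫ x, φ x * ψ x := by
    refine (abs_integral_le_integral_abs (μ := volume)).trans (integral_mono_of_nonneg (ae_of_all _ fun x => abs_nonneg _)
      ((hφc.mul hψc).integrable_unitAddTorus) (ae_of_all _ fun x => ?_))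
    calc |⟪wordDeriv α (fun y => v y j) x • wordDeriv β (Torus.partialDeriv j v) x, wordDeriv w v x⟫|
        ≤ ‖wordDeriv α (fun y => v y j) x • wordDeriv β (Torus.partialDeriv j v) x‖ * ‖wordDeriv w v x‖ :=
          abs_real_inner_le_norm _ _
      _ = φ x * ψ x := by rw [norm_smul, Real.norm_eq_abs]
  -- Cauchy–Schwarz and the two `L²` bounds
  have h2 : ∫ x, φ x * ψ x ≤ Real.sqrt (∫ x, φ x ^ 2) * Real.sqrt (∫ x, ψ x ^ 2) :=
    integral_mul_le_sqrt_mul_sqrt' hφc hψc (fun x => by positivity) (fun x => norm_nonneg _)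
  have hαv : IsSmooth (wordDeriv α v) := isSmooth_wordDeriv hv α
  have h3 : ∫ x, φ x ^ 2 ≤ 2 * C * M ^ 2 * wordEnergy N v := by
    have hpt : ∀ x, φ x ^ 2 ≤ ‖wordDeriv α v x‖ ^ 2 * ‖wordDeriv β (Torus.partialDeriv j v) x‖ ^ 2 := by
      intro x
      simp only [hφ_def]
      rw [mul_pow]
      refine mul_le_mul_of_nonneg_right (pow_le_pow_left₀ (abs_nonneg _) ?_ 2) (sq_nonneg _)
      rw [← wordDeriv_apply_coord hv j α x, ← Real.norm_eq_abs]
      exact PiLp.norm_apply_le (wordDeriv α v x) j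
    have hi : Integrable (fun x => ‖wordDeriv α v x‖ ^ 2 * ‖wordDeriv β (Torus.partialDeriv j v) x‖ ^ 2) volume :=
      ((hαv.continuous.norm.pow 2).mul (hβ_s.continuous.norm.pow 2)).integrable_unitAddTorus
    exact (integral_mono ((hφc.pow 2).integrable_unitAddTorus) hi hpt).trans
      (integral_normSq_wordDeriv_mul_le hv hM0 hM hC0 hC hα hαβ j)
  have h4 : ∫ x, ψ x ^ 2 ≤ wordEnergy N v := by
    simp only [hψ_def]
    have := integral_norm_sq_wordDeriv_le_wordEnergy (fun i : Fin w.length => w.get i) v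
    rw [List.ofFn_get, hw] at this
    exact this
  have hE0 : 0 ≤ wordEnergy N v := wordEnergy_nonneg _ _
  calc |∫ x, ⟪wordDeriv α (fun y => v y j) x • wordDeriv β (Torus.partialDeriv j v) x, wordDeriv w v x⟫|
      ≤ Real.sqrt (∫ x, φ x ^ 2) * Real.sqrt (∫ x, ψ x ^ 2) := h1.trans h2
    _ ≤ Real.sqrt (2 * C * M ^ 2 * wordEnergy N v) * Real.sqrt (wordEnergy N v) :=
        mul_le_mul (Real.sqrt_le_sqrt h3) (Real.sqrt_le_sqrt h4) (Real.sqrt_nonneg _) (Real.sqrt_nonneg _)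
    _ = Real.sqrt (2 * C) * M * wordEnergy N v := by
        rw [show 2 * C * M ^ 2 * wordEnergy N v = (2 * C) * (M ^ 2 * wordEnergy N v) by ring,
          Real.sqrt_mul (by positivity), Real.sqrt_mul (sq_nonneg M), Real.sqrt_sq hM0, mul_assoc, mul_assoc,
          mul_assoc, Real.mul_self_sqrt hE0]


/-- **The nonlinear term of the `H_N`-balance**, `NL_N(v) = ∑_{|w|=N} ∫ ⟪∂^w((v·∇)v), ∂^w v⟫`
(`= ∫ (DᴺU)·Dᴺ[(u·∇)u]`, Doering–Gibbon (6.2.12)). [cite: DoeringGibbon1995, §6.2 (6.2.12)] -/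
def ladderNonlinear (N : ℕ) (v : UnitAddTorus d → EuclideanSpace ℝ d) : ℝ :=
  ∑ w : Fin N → d, ∫ x, ⟪wordDeriv (List.ofFn w) (Torus.convect v v) x, wordDeriv (List.ofFn w) v x⟫

/-- **Doering–Gibbon's estimate of the nonlinear term at every rung** ((6.2.25):
`|NL term| ≤ c_N H_N ‖Du‖_∞`): for every `N` there is `c = c(card d, N)` such that for every smooth
divergence-free `v : T^d → ℝ^d` and every `M ≥ 0` with `∑ᵢ ‖∂ᵢv(x)‖² ≤ M²` for all `x`,
`|NL_N(v)| ≤ c M E_N(v)`, `E_N(v) = ∑_{|w|=N} ∫ ‖∂^w v‖² = H_N`. Proof as printed: Leibniz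
(`wordDeriv_convect_apply`), the transport term vanishes (`integral_inner_convect_self_right_eq_zero`), Hölder
and the Gagliardo–Nirenberg calculus inequalities with `a = (l−1)/(N−1)`, `ap = 2`
(`abs_integral_inner_term_le`). [cite: DoeringGibbon1995, §6.2 (6.2.12)–(6.2.25), Lemma 6.1]
(every rung, any dimension; the torus rendering and the constant are ours) -/
theorem exists_abs_ladderNonlinear_le (d : Type*) [Fintype d] [DecidableEq d] (N : ℕ) :
    ∃ c : ℝ, 0 ≤ c ∧ ∀ (v : UnitAddTorus d → EuclideanSpace ℝ d), IsSmooth v → IsDivFree v → ∀ M : ℝ, 0 ≤ M →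
      (∀ x, ∑ i, ‖Torus.partialDeriv i v x‖ ^ 2 ≤ M ^ 2) → |ladderNonlinear N v| ≤ c * M * wordEnergy N v := by
  obtain ⟨C, hC0, hC⟩ := exists_uniform_bilinear d (EuclideanSpace ℝ d) (N - 1)
  set K : ℝ := Real.sqrt (2 * C) with hK
  -- the number of terms, weighted by `K`
  refine ⟨(∑ w : Fin N → d, ∑ _j : d, ((lowerSplits (List.ofFn w)).length : ℝ)) * K, by positivity,
    fun v hv hdiv M hM0 hM => ?_⟩
  have hE0 : 0 ≤ wordEnergy N v := wordEnergy_nonneg _ _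
  unfold ladderNonlinear
  -- word by word
  have hword : ∀ w : Fin N → d,
      |∫ x, ⟪wordDeriv (List.ofFn w) (Torus.convect v v) x, wordDeriv (List.ofFn w) v x⟫| ≤
        (∑ _j : d, ((lowerSplits (List.ofFn w)).length : ℝ)) * K * M * wordEnergy N v := by
    intro w
    set W := List.ofFn w with hW
    have hWlen : W.length = N := by simp [hW]
    have hWs : IsSmooth (wordDeriv W v) := isSmooth_wordDeriv hv W
    -- Leibniz + transport
    have hdec : ∫ x, ⟪wordDeriv W (Torus.convect v v) x, wordDeriv W v x⟫ =
        ∑ j, ∑ k : Fin (lowerSplits W).length,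
          ∫ x, ⟪wordDeriv ((lowerSplits W).get k).1 (fun y => v y j) x •
            wordDeriv ((lowerSplits W).get k).2 (Torus.partialDeriv j v) x, wordDeriv W v x⟫ := by
      have hterm : ∀ (j : d) (k : Fin (lowerSplits W).length), Integrable (fun x =>
          ⟪wordDeriv ((lowerSplits W).get k).1 (fun y => v y j) x •
            wordDeriv ((lowerSplits W).get k).2 (Torus.partialDeriv j v) x, wordDeriv W v x⟫) volume := fun j k =>
        (((isSmooth_wordDeriv (hv.apply j) _).smul' (isSmooth_wordDeriv (hv.partialDeriv j) _)).inner hWs).integrable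
      simp_rw [wordDeriv_convect_apply hv W, inner_add_left, lowCommS_eq_sum_fin, sum_inner]
      rw [integral_add ((hv.convect hWs).inner hWs).integrable
        (integrable_finsetSum _ fun j _ => integrable_finsetSum _ fun k _ => hterm j k),
        integral_inner_convect_self_right_eq_zero hv hdiv hWs, zero_add,
        integral_finsetSum _ fun j _ => integrable_finsetSum _ fun k _ => hterm j k]
      exact Finset.sum_congr rfl fun j _ => integral_finsetSum _ fun k _ => hterm j k
    rw [hdec]
    refine (Finset.abs_sum_le_sum_abs _ _).trans ?_
    rw [Finset.sum_mul, Finset.sum_mul, Finset.sum_mul]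
    refine Finset.sum_le_sum fun j _ => (Finset.abs_sum_le_sum_abs _ _).trans ?_
    have hk : ∀ k : Fin (lowerSplits W).length,
        |∫ x, ⟪wordDeriv ((lowerSplits W).get k).1 (fun y => v y j) x •
            wordDeriv ((lowerSplits W).get k).2 (Torus.partialDeriv j v) x, wordDeriv W v x⟫| ≤ K * M * wordEnergy N v := by
      intro k
      obtain ⟨hne, hlen⟩ := mem_lowerSplits (List.get_mem (lowerSplits W) k)
      rw [hWlen] at hlen
      exact abs_integral_inner_term_le hv hM0 hM hC0 hC hne hlen hWlen j
    calc ∑ k : Fin (lowerSplits W).length, |∫ x, ⟪wordDeriv ((lowerSplits W).get k).1 (fun y => v y j) x •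
            wordDeriv ((lowerSplits W).get k).2 (Torus.partialDeriv j v) x, wordDeriv W v x⟫|
        ≤ ∑ _k : Fin (lowerSplits W).length, K * M * wordEnergy N v := Finset.sum_le_sum fun k _ => hk k
      _ = ((lowerSplits W).length : ℝ) * K * M * wordEnergy N v := by
          rw [Finset.sum_const, Finset.card_univ, Fintype.card_fin, nsmul_eq_mul]; ring
  calc |∑ w : Fin N → d, ∫ x, ⟪wordDeriv (List.ofFn w) (Torus.convect v v) x, wordDeriv (List.ofFn w) v x⟫|
      ≤ ∑ w : Fin N → d, |∫ x, ⟪wordDeriv (List.ofFn w) (Torus.convect v v) x, wordDeriv (List.ofFn w) v x⟫| :=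
        Finset.abs_sum_le_sum_abs _ _
    _ ≤ ∑ w : Fin N → d, (∑ _j : d, ((lowerSplits (List.ofFn w)).length : ℝ)) * K * M * wordEnergy N v :=
        Finset.sum_le_sum fun w _ => hword w
    _ = (∑ w : Fin N → d, ∑ _j : d, ((lowerSplits (List.ofFn w)).length : ℝ)) * K * M * wordEnergy N v := by
        rw [Finset.sum_mul, Finset.sum_mul, Finset.sum_mul]


/-! ## The word-energy balance along classical Navier–Stokes solutions -/

/-- `∂^w Δf = Δ ∂^w f` for smooth `f` (`Δ = ∑ᵢ ∂ᵢ∂ᵢ` and `wordDeriv_partialDeriv_comm`; moving `Dᴺ` through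
the Laplacian term, Doering–Gibbon (6.2.10)–(6.2.11)). [cite: DoeringGibbon1995, §6.2 (6.2.10)–(6.2.11)]
(bookkeeping) -/
theorem wordDeriv_laplacian_comm {f : UnitAddTorus d → F'} (hf : IsSmooth f) (w : List d) :
    wordDeriv w (Torus.laplacian f) = Torus.laplacian (wordDeriv w f) := by
  have hL : ∀ {g : UnitAddTorus d → F'}, IsSmooth g →
      Torus.laplacian g = fun y => ∑ i, Torus.partialDeriv i (Torus.partialDeriv i g) y :=
    fun hg => funext (laplacian_eq_sum_partialDeriv_partialDeriv hg)
  rw [hL hf, hL (isSmooth_wordDeriv hf w),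
    wordDeriv_fun_finset_sum _ (fun i _ => (hf.partialDeriv i).partialDeriv i) w]
  funext y
  refine Finset.sum_congr rfl fun i _ => ?_
  rw [wordDeriv_partialDeriv_comm (hf.partialDeriv i) i w, wordDeriv_partialDeriv_comm hf i w]

/-- Word derivatives of a smooth divergence-free field are divergence free (why the pressure term
drops out of the `H_N`-balance, Doering–Gibbon §6.2 Step 3). [cite: DoeringGibbon1995, §6.2 Step 3]
(bookkeeping) -/
theorem isDivFree_wordDeriv {u : UnitAddTorus d → EuclideanSpace ℝ d} (hu : IsSmooth u) (hdiv : IsDivFree u)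
    (w : List d) : IsDivFree (wordDeriv w u) := by
  intro x
  have h0 : Torus.divergence u = fun _ => (0 : ℝ) := funext hdiv
  have h := congrFun (wordDeriv_divergence_comm hu w) x
  rw [h0, wordDeriv_zero w] at h
  exact h.symm

/-- **The balance of `½ ∫ ‖∂^w u‖²` along a classical Navier–Stokes solution on the torus**, for
every word `w`: for a classical solution of `∂ₜu + (u·∇)u = νΔu − ∇p + f`, `div u = 0` on
`T^d × [a, b]`, `a < b`, and `t ∈ [a, b]`,
`d/dt ½ ∫ ‖∂^w u‖² = −ν ‖∇∂^w u‖₂² − ∫ ⟪∂^w((u·∇)u), ∂^w u⟫ + ∫ ⟪∂^w f, ∂^w u⟫`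
(one-sided within `[a, b]`): differentiate under the integral, commute `∂ₜ` and `Δ` with `∂^w`,
insert the momentum equation; the pressure drops out because `∂^w u` is divergence free
(Doering–Gibbon (6.2.8) word by word, with the Laplacian term (6.2.11) and the pressure Step 3).
[cite: DoeringGibbon1995, §6.2 (6.2.8)–(6.2.11)] -/
theorem _root_.Literature.Analysis.FunctionSpaces.Torus.IsClassicalNSSolutionOn.hasDerivWithinAt_half_integral_norm_sq_wordDeriv
    {a b ν : ℝ} {f u : ℝ → UnitAddTorus d → EuclideanSpace ℝ d} {p : ℝ → UnitAddTorus d → ℝ}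
    (h : Torus.IsClassicalNSSolutionOn (Icc a b) ν f u p) (hab : a < b) (W : List d) {t : ℝ}
    (ht : t ∈ Icc a b) :
    HasDerivWithinAt (fun s => 2⁻¹ * ∫ x, ‖wordDeriv W (u s) x‖ ^ 2)
      (-ν * Torus.gradNormSq (wordDeriv W (u t)) -
          (∫ x, ⟪wordDeriv W (Torus.convect (u t) (u t)) x, wordDeriv W (u t) x⟫) +
        ∫ x, ⟪wordDeriv W (f t) x, wordDeriv W (u t) x⟫) (Icc a b) t := by
  set S : Set ℝ := Icc a b with hSdef
  have hSc : Convex ℝ S := convex_Icc a b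
  have hU : UniqueDiffOn ℝ S := uniqueDiffOn_Icc hab
  have hu : Torus.IsSmoothSpaceTimeOn S u := h.smooth_velocity
  have hut : IsSmooth (u t) := hu.isSmooth_slice ht
  have hpt : IsSmooth (p t) := h.smooth_pressure.isSmooth_slice ht
  have hA : IsSmooth (Torus.timeDerivWithin S u t) := hu.isSmooth_timeDerivWithin hU ht
  have hWst : Torus.IsSmoothSpaceTimeOn S (fun s => wordDeriv W (u s)) := isSmoothSpaceTimeOn_wordDeriv hu hU W
  have hW : IsSmooth (wordDeriv W (u t)) := isSmooth_wordDeriv hut W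
  -- Step 1: differentiate under the integral sign.
  have hφ : Torus.IsSmoothSpaceTimeOn S (fun s x => ‖wordDeriv W (u s) x‖ ^ 2) := hWst.norm_sq ℝ
  have hE : HasDerivWithinAt (fun s => 2⁻¹ * ∫ x, ‖wordDeriv W (u s) x‖ ^ 2)
      (2⁻¹ * ∫ x, Torus.timeDerivWithin S (fun s x => ‖wordDeriv W (u s) x‖ ^ 2) t x) S t :=
    (hφ.hasDerivWithinAt_integral hSc ht).const_mul 2⁻¹
  -- Step 2: `∂ₜ ‖∂^w u‖² = 2 ⟪∂^w ∂ₜu, ∂^w u⟫`.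
  have htd : ∀ x, Torus.timeDerivWithin S (fun s x => ‖wordDeriv W (u s) x‖ ^ 2) t x =
      2 * ⟪wordDeriv W (Torus.timeDerivWithin S u t) x, wordDeriv W (u t) x⟫ := by
    intro x
    have h1 := ((hWst.hasDerivWithinAt_slice ht x).norm_sq).derivWithin (hU t ht)
    rw [Torus.timeDerivWithin, h1, ← timeDerivWithin_wordDeriv_comm hab hu ht W x, real_inner_comm]
  have hE' : 2⁻¹ * ∫ x, Torus.timeDerivWithin S (fun s x => ‖wordDeriv W (u s) x‖ ^ 2) t x =
      ∫ x, ⟪wordDeriv W (Torus.timeDerivWithin S u t) x, wordDeriv W (u t) x⟫ := by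
    simp_rw [htd, integral_const_mul]
    ring
  rw [hE'] at hE
  convert hE using 1
  -- Step 3: insert the differentiated momentum equation.
  have hΔ : IsSmooth (Torus.laplacian (u t)) := hut.laplacian
  have hft : IsSmooth (f t) := by
    have hfun : f t = fun x => Torus.timeDerivWithin S u t x +
        Torus.convect (u t) (u t) x - ν • Torus.laplacian (u t) x + Torus.gradient (p t) x := by
      funext x
      rw [h.momentum t ht x]
      abel
    rw [hfun]
    exact ((hA.add (hut.convect hut)).sub (hΔ.smul ν)).add hpt.gradient
  have hA_eq : Torus.timeDerivWithin S u t =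
      ν • Torus.laplacian (u t) - Torus.gradient (p t) + f t - Torus.convect (u t) (u t) := by
    funext x
    simp only [Pi.sub_apply, Pi.add_apply, Pi.smul_apply]
    rw [← h.momentum t ht x]
    abel
  have hWA : ∀ x, wordDeriv W (Torus.timeDerivWithin S u t) x =
      ν • wordDeriv W (Torus.laplacian (u t)) x - wordDeriv W (Torus.gradient (p t)) x +
        wordDeriv W (f t) x - wordDeriv W (Torus.convect (u t) (u t)) x := by
    intro x
    rw [hA_eq, wordDeriv_sub ((((hΔ.smul ν).sub hpt.gradient)).add hft) (hut.convect hut),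
      wordDeriv_add ((hΔ.smul ν).sub hpt.gradient) hft, wordDeriv_sub (hΔ.smul ν) hpt.gradient,
      wordDeriv_const_smul hΔ ν]
    simp only [Pi.sub_apply, Pi.add_apply, Pi.smul_apply]
  have hWΔ : IsSmooth (wordDeriv W (Torus.laplacian (u t))) := isSmooth_wordDeriv hΔ W
  have hWg : IsSmooth (wordDeriv W (Torus.gradient (p t))) := isSmooth_wordDeriv hpt.gradient W
  have hWf : IsSmooth (wordDeriv W (f t)) := isSmooth_wordDeriv hft W
  have hWc : IsSmooth (wordDeriv W (Torus.convect (u t) (u t))) := isSmooth_wordDeriv (hut.convect hut) W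
  have iL : Integrable (fun x => ⟪ν • wordDeriv W (Torus.laplacian (u t)) x, wordDeriv W (u t) x⟫) volume :=
    ((hWΔ.smul ν).inner hW).integrable
  have iG : Integrable (fun x => ⟪wordDeriv W (Torus.gradient (p t)) x, wordDeriv W (u t) x⟫) volume :=
    (hWg.inner hW).integrable
  have iF : Integrable (fun x => ⟪wordDeriv W (f t) x, wordDeriv W (u t) x⟫) volume :=
    (hWf.inner hW).integrable
  have iC : Integrable (fun x => ⟪wordDeriv W (Torus.convect (u t) (u t)) x, wordDeriv W (u t) x⟫) volume :=
    (hWc.inner hW).integrable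
  have hsplit : ∫ x, ⟪wordDeriv W (Torus.timeDerivWithin S u t) x, wordDeriv W (u t) x⟫ =
      (∫ x, ⟪ν • wordDeriv W (Torus.laplacian (u t)) x, wordDeriv W (u t) x⟫) -
        (∫ x, ⟪wordDeriv W (Torus.gradient (p t)) x, wordDeriv W (u t) x⟫) +
        (∫ x, ⟪wordDeriv W (f t) x, wordDeriv W (u t) x⟫) -
        ∫ x, ⟪wordDeriv W (Torus.convect (u t) (u t)) x, wordDeriv W (u t) x⟫ := by
    simp_rw [hWA, inner_sub_left, inner_add_left, inner_sub_left]
    rw [integral_sub ?_ iC, integral_add ?_ iF, integral_sub iL iG]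
    · exact iL.sub iG
    · exact (iL.sub iG).add iF
  -- the viscous term: `ν ∫ ⟪∂^w Δu, ∂^w u⟫ = ν ∫ ⟪Δ ∂^w u, ∂^w u⟫ = −ν ‖∇∂^w u‖₂²`
  have hvisc : ∫ x, ⟪ν • wordDeriv W (Torus.laplacian (u t)) x, wordDeriv W (u t) x⟫ =
      -ν * Torus.gradNormSq (wordDeriv W (u t)) := by
    simp_rw [real_inner_smul_left, integral_const_mul]
    rw [wordDeriv_laplacian_comm hut W, integral_inner_laplacian_self_eq_neg_gradNormSq hW]
    ring
  -- the pressure term vanishes: `∂^w ∇p = ∇ ∂^w p` and `∂^w u` is divergence free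
  have hpres : ∫ x, ⟪wordDeriv W (Torus.gradient (p t)) x, wordDeriv W (u t) x⟫ = 0 := by
    rw [wordDeriv_gradient_comm hpt W]
    exact integral_inner_gradient_eq_zero_of_isDivFree hW (isSmooth_wordDeriv hpt W)
      (isDivFree_wordDeriv hut (h.divFree t ht) W)
  rw [hsplit, hvisc, hpres]
  ring

/-- The word forcing pairing of order `N`: `∑_{|w|=N} ∫ ⟪∂^w f, ∂^w v⟫` (`∫ DᴺU · Dᴺf`,
Doering–Gibbon (6.2.12)). [cite: DoeringGibbon1995, §6.2 (6.2.12)] -/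
def wordForcing (N : ℕ) (g v : UnitAddTorus d → EuclideanSpace ℝ d) : ℝ :=
  ∑ w : Fin N → d, ∫ x, ⟪wordDeriv (List.ofFn w) g x, wordDeriv (List.ofFn w) v x⟫

/-- **The `H_N`-balance of classical Navier–Stokes solutions on the torus, every `N`**
(Doering–Gibbon (6.2.12): `½ Ḣ_N = −ν H_{N+1} − ∫ DᴺU·Dᴺ[(u·∇)u] + ∫ DᴺU·Dᴺf`): for a classical
solution on `T^d × [a, b]`, `a < b`, every `N` and `t ∈ [a, b]`,
`d/dt ½ E_N(u) = −ν E_{N+1}(u) − NL_N(u) + ∑_{|w|=N} ∫ ⟪∂^w f, ∂^w u⟫` within `[a, b]`, where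
`E_N = wordEnergy N` (`= H_N`, all ordered words of length `N`). [cite: DoeringGibbon1995, §6.2 (6.2.12)] -/
theorem _root_.Literature.Analysis.FunctionSpaces.Torus.IsClassicalNSSolutionOn.hasDerivWithinAt_half_wordEnergy
    {a b ν : ℝ} {f u : ℝ → UnitAddTorus d → EuclideanSpace ℝ d} {p : ℝ → UnitAddTorus d → ℝ}
    (h : Torus.IsClassicalNSSolutionOn (Icc a b) ν f u p) (hab : a < b) (N : ℕ) {t : ℝ}
    (ht : t ∈ Icc a b) :
    HasDerivWithinAt (fun s => 2⁻¹ * wordEnergy N (u s))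
      (-ν * wordEnergy (N + 1) (u t) - ladderNonlinear N (u t) + wordForcing N (f t) (u t)) (Icc a b) t := by
  have hut : IsSmooth (u t) := h.smooth_velocity.isSmooth_slice ht
  have hsum := HasDerivWithinAt.fun_sum (u := Finset.univ)
    (A := fun (w : Fin N → d) (s : ℝ) => 2⁻¹ * ∫ x, ‖wordDeriv (List.ofFn w) (u s) x‖ ^ 2)
    fun w _ => h.hasDerivWithinAt_half_integral_norm_sq_wordDeriv hab (List.ofFn w) ht
  have hfun : (fun s => 2⁻¹ * wordEnergy N (u s)) =
      fun s => ∑ w : Fin N → d, 2⁻¹ * ∫ x, ‖wordDeriv (List.ofFn w) (u s) x‖ ^ 2 := by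
    funext s
    rw [wordEnergy, Finset.mul_sum]
  rw [hfun]
  refine hsum.congr_deriv ?_
  rw [Finset.sum_add_distrib, Finset.sum_sub_distrib, wordEnergy_succ', Finset.mul_sum]
  unfold ladderNonlinear wordForcing
  congr 1
  congr 1
  refine Finset.sum_congr rfl fun w _ => ?_
  have hint : ∀ i, Integrable (fun x => ‖Torus.partialDeriv i (wordDeriv (List.ofFn w) (u t)) x‖ ^ 2) volume :=
    fun i => ((((isSmooth_wordDeriv hut _).partialDeriv i).continuous.norm.pow 2)).integrable_unitAddTorus
  rw [Torus.gradNormSq, integral_finsetSum _ fun i _ => hint i]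


/-! ## The ladder inequality -/

/-- The forcing slices of a classical solution on a slab are smooth (read off the momentum equation).
[folklore] -/
private theorem isSmooth_force_slice {a b ν : ℝ} {f u : ℝ → UnitAddTorus d → EuclideanSpace ℝ d}
    {p : ℝ → UnitAddTorus d → ℝ} (h : Torus.IsClassicalNSSolutionOn (Icc a b) ν f u p) (hab : a < b) {t : ℝ}
    (ht : t ∈ Icc a b) : IsSmooth (f t) := by
  have hut : IsSmooth (u t) := h.smooth_velocity.isSmooth_slice ht
  have hfun : f t = fun x => Torus.timeDerivWithin (Icc a b) u t x +
      Torus.convect (u t) (u t) x - ν • Torus.laplacian (u t) x + Torus.gradient (p t) x := by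
    funext x
    rw [h.momentum t ht x]
    abel
  rw [hfun]
  exact (((h.smooth_velocity.isSmooth_timeDerivWithin (uniqueDiffOn_Icc hab) ht).add (hut.convect hut)).sub
    (hut.laplacian.smul ν)).add (h.smooth_pressure.isSmooth_slice ht).gradient

/-- **Cauchy–Schwarz for the forcing pairing** (Doering–Gibbon (6.2.26),
`|∫ DᴺU·Dᴺf| ≤ H_N^{1/2} Φ_N^{1/2}`): `|∑_{|w|=N} ∫ ⟪∂^w g, ∂^w v⟫| ≤ E_N(v)^{1/2} E_N(g)^{1/2}`.
[cite: DoeringGibbon1995, §6.2 (6.2.26)] -/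
theorem abs_wordForcing_le {g v : UnitAddTorus d → EuclideanSpace ℝ d} (hg : IsSmooth g) (hv : IsSmooth v)
    (N : ℕ) : |wordForcing N g v| ≤ Real.sqrt (wordEnergy N v) * Real.sqrt (wordEnergy N g) := by
  unfold wordForcing wordEnergy
  refine (Finset.abs_sum_le_sum_abs _ _).trans ?_
  have hw : ∀ w : Fin N → d, |∫ x, ⟪wordDeriv (List.ofFn w) g x, wordDeriv (List.ofFn w) v x⟫| ≤
      Real.sqrt (∫ x, ‖wordDeriv (List.ofFn w) v x‖ ^ 2) *
        Real.sqrt (∫ x, ‖wordDeriv (List.ofFn w) g x‖ ^ 2) := by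
    intro w
    rw [mul_comm]
    exact abs_integral_inner_le_sqrt_mul_sqrt_of_isSmooth (isSmooth_wordDeriv hg (List.ofFn w))
      (isSmooth_wordDeriv hv (List.ofFn w))
  calc ∑ w : Fin N → d, |∫ x, ⟪wordDeriv (List.ofFn w) g x, wordDeriv (List.ofFn w) v x⟫|
      ≤ ∑ w : Fin N → d, Real.sqrt (∫ x, ‖wordDeriv (List.ofFn w) v x‖ ^ 2) *
          Real.sqrt (∫ x, ‖wordDeriv (List.ofFn w) g x‖ ^ 2) := Finset.sum_le_sum fun w _ => hw w
    _ ≤ Real.sqrt (∑ w : Fin N → d, Real.sqrt (∫ x, ‖wordDeriv (List.ofFn w) v x‖ ^ 2) ^ 2) *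
          Real.sqrt (∑ w : Fin N → d, Real.sqrt (∫ x, ‖wordDeriv (List.ofFn w) g x‖ ^ 2) ^ 2) :=
        Real.sum_mul_le_sqrt_mul_sqrt _ _ _
    _ = Real.sqrt (∑ w : Fin N → d, ∫ x, ‖wordDeriv (List.ofFn w) v x‖ ^ 2) *
          Real.sqrt (∑ w : Fin N → d, ∫ x, ‖wordDeriv (List.ofFn w) g x‖ ^ 2) := by
        congr 2 <;> exact Finset.sum_congr rfl fun w _ => Real.sq_sqrt (integral_nonneg fun _ => sq_nonneg _)

/-- **The Doering–Gibbon ladder inequality, every rung, any dimension** (Thm 6.1; Step 5 of its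
proof, (6.2.27): `½ Ḣ_N ≤ −ν H_{N+1} + c_N ‖Du‖_∞ H_N + H_N^{1/2} Φ_N^{1/2}`): for every `N` there is a
dimensionless `c = c(card d, N) ≥ 0` such that for every classical solution of the forced
incompressible Navier–Stokes system on `T^d × [a, b]`, `a < b`, every `t ∈ [a, b]` and every `M ≥ 0`
with `∑ᵢ ‖∂ᵢu(t, x)‖² ≤ M²` for all `x` (a sup bound for the Frobenius norm of `Du(t)`), the one-sided
derivative of `½ E_N(u) = ½ H_N` within `[a, b]` satisfies
`d/dt ½ E_N(u(t)) ≤ −ν E_{N+1}(u(t)) + c M E_N(u(t)) + E_N(u(t))^{1/2} E_N(f(t))^{1/2}`,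
`E_N = wordEnergy N` (all ordered words of length `N`; `E_N(f) = Φ_N`). The rung `N = 2` with the
explicit constant `c₂ = 3` (and `f = 0`) is `TorusPalinstrophyLadder`; here `c_N` is inexplicit.
[cite: DoeringGibbon1995, Thm 6.1, §6.2 (6.2.27)] -/
theorem exists_ladder_inequality (d : Type*) [Fintype d] [DecidableEq d] (N : ℕ) :
    ∃ c : ℝ, 0 ≤ c ∧ ∀ {a b ν : ℝ} {f u : ℝ → UnitAddTorus d → EuclideanSpace ℝ d} {p : ℝ → UnitAddTorus d → ℝ},
      Torus.IsClassicalNSSolutionOn (Icc a b) ν f u p → a < b → ∀ {t : ℝ}, t ∈ Icc a b → ∀ M : ℝ, 0 ≤ M →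
        (∀ x, ∑ i, ‖Torus.partialDeriv i (u t) x‖ ^ 2 ≤ M ^ 2) →
        derivWithin (fun s => 2⁻¹ * wordEnergy N (u s)) (Icc a b) t ≤
          -ν * wordEnergy (N + 1) (u t) + c * M * wordEnergy N (u t) +
            Real.sqrt (wordEnergy N (u t)) * Real.sqrt (wordEnergy N (f t)) := by
  obtain ⟨c, hc0, hc⟩ := exists_abs_ladderNonlinear_le d N
  refine ⟨c, hc0, fun {a b ν f u p} h hab t ht M hM0 hM => ?_⟩
  have hut : IsSmooth (u t) := h.smooth_velocity.isSmooth_slice ht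
  rw [(h.hasDerivWithinAt_half_wordEnergy hab N ht).derivWithin (uniqueDiffOn_Icc hab t ht)]
  have h1 := hc (u t) hut (h.divFree t ht) M hM0 hM
  have h2 := abs_wordForcing_le (isSmooth_force_slice h hab ht) hut N
  linarith [neg_abs_le (ladderNonlinear N (u t)), le_abs_self (wordForcing N (f t) (u t))]

/-- **Integrated form**: under the hypotheses of `exists_ladder_inequality` with the gradient bound
`∑ᵢ ‖∂ᵢu(s, x)‖² ≤ M²` on all of `[a, b] × T^d` and no forcing (`f = 0`), `E_N(u(t)) ≤ E_N(u(a)) e^{2cM(t−a)}`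
for `t ∈ [a, b]` (Grönwall on (6.2.27) with the viscous term dropped). [cite: DoeringGibbon1995, Thm 6.1, §6.2 (6.2.27)]
(every rung; the Grönwall step is ours as bookkeeping) -/
theorem exists_wordEnergy_le_exp (d : Type*) [Fintype d] [DecidableEq d] (N : ℕ) :
    ∃ c : ℝ, 0 ≤ c ∧ ∀ {a b ν : ℝ} {u : ℝ → UnitAddTorus d → EuclideanSpace ℝ d} {p : ℝ → UnitAddTorus d → ℝ},
      Torus.IsClassicalNSSolutionOn (Icc a b) ν (fun _ _ => 0) u p → a < b → 0 ≤ ν → ∀ M : ℝ, 0 ≤ M →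
        (∀ s ∈ Icc a b, ∀ x, ∑ i, ‖Torus.partialDeriv i (u s) x‖ ^ 2 ≤ M ^ 2) →
        ∀ {t : ℝ}, t ∈ Icc a b → wordEnergy N (u t) ≤ wordEnergy N (u a) * Real.exp (2 * c * M * (t - a)) := by
  obtain ⟨c, hc0, hc⟩ := exists_abs_ladderNonlinear_le d N
  refine ⟨c, hc0, fun {a b ν u p} h hab hν M hM0 hM t ht => ?_⟩
  -- Grönwall for `E(s) = wordEnergy N (u s)` with `E' ≤ 2 c M E` within `[a, b]`
  have hderiv : ∀ s ∈ Icc a b, HasDerivWithinAt (fun s => wordEnergy N (u s))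
      (2 * (-ν * wordEnergy (N + 1) (u s) - ladderNonlinear N (u s) + wordForcing N (fun _ => (0 : EuclideanSpace ℝ d)) (u s)))
      (Icc a b) s := by
    intro s hs
    have h2 := (h.hasDerivWithinAt_half_wordEnergy hab N hs).const_mul 2
    have hfun : (fun s => wordEnergy N (u s)) = fun s => 2 * (2⁻¹ * wordEnergy N (u s)) := by
      funext s; ring
    rw [hfun]
    exact h2
  have hbound : ∀ s ∈ Icc a b,
      2 * (-ν * wordEnergy (N + 1) (u s) - ladderNonlinear N (u s) + wordForcing N (fun _ => (0 : EuclideanSpace ℝ d)) (u s))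
        ≤ 2 * c * M * wordEnergy N (u s) := by
    intro s hs
    have hus : IsSmooth (u s) := h.smooth_velocity.isSmooth_slice hs
    have h1 := hc (u s) hus (h.divFree s hs) M hM0 (hM s hs)
    have hF : wordForcing N (fun _ => (0 : EuclideanSpace ℝ d)) (u s) = 0 := by
      unfold wordForcing
      refine Finset.sum_eq_zero fun w _ => ?_
      rw [wordDeriv_zero]
      simp
    have hE1 : 0 ≤ wordEnergy (N + 1) (u s) := wordEnergy_nonneg _ _
    rw [hF]
    nlinarith [neg_abs_le (ladderNonlinear N (u s)), mul_nonneg hν hE1]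
  -- Grönwall (Mathlib's `le_gronwallBound_of_liminf_deriv_right_le` with `ε = 0`)
  have hcont : ContinuousOn (fun s => wordEnergy N (u s)) (Icc a b) :=
    fun s hs => (hderiv s hs).continuousWithinAt
  have key := le_gronwallBound_of_liminf_deriv_right_le (δ := wordEnergy N (u a)) (K := 2 * c * M) (ε := 0) hcont
    (fun s hs r hr => (((hderiv s (Ico_subset_Icc_self hs)).mono_of_mem_nhdsWithin
      (Icc_mem_nhdsGE_of_mem hs)).liminf_right_slope_le hr).mono fun z hz => by
        rwa [slope_def_module, smul_eq_mul] at hz)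
    le_rfl (fun s hs => by have := hbound s (Ico_subset_Icc_self hs); linarith) t ht
  rwa [gronwallBound_ε0] at key


/-! ## Interpolation between rungs (Doering–Gibbon Lemma 6.2) -/

/-- `∫ ⟪∂ᵢ∂ᵢU, ∂ⱼ∂ⱼU⟫ = ∫ ‖∂ⱼ∂ᵢU‖²` (integrate by parts twice and commute the derivatives; the
integration by parts of Doering–Gibbon Lemma 6.2, Step A (6.2.30)).
[cite: DoeringGibbon1995, §6.2 Lemma 6.2, Step A (6.2.30)] (bookkeeping) -/
theorem integral_inner_partialDeriv₂_partialDeriv₂ {U : UnitAddTorus d → F'} (hU : IsSmooth U) (i j : d) :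
    ∫ x, ⟪Torus.partialDeriv i (Torus.partialDeriv i U) x, Torus.partialDeriv j (Torus.partialDeriv j U) x⟫ =
      ∫ x, ‖Torus.partialDeriv j (Torus.partialDeriv i U) x‖ ^ 2 := by
  have hi : IsSmooth (Torus.partialDeriv i U) := hU.partialDeriv i
  have hj : IsSmooth (Torus.partialDeriv j U) := hU.partialDeriv j
  have hji : IsSmooth (Torus.partialDeriv j (Torus.partialDeriv i U)) := hi.partialDeriv j
  rw [integral_inner_partialDeriv_eq_neg hi (hj.partialDeriv j) i]
  have e1 : ∀ x, Torus.partialDeriv i (Torus.partialDeriv j (Torus.partialDeriv j U)) x =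
      Torus.partialDeriv j (Torus.partialDeriv j (Torus.partialDeriv i U)) x := by
    intro x
    rw [partialDeriv_comm hj i j x]
    have : Torus.partialDeriv i (Torus.partialDeriv j U) = Torus.partialDeriv j (Torus.partialDeriv i U) :=
      funext (partialDeriv_comm hU i j)
    rw [this]
  simp_rw [e1]
  rw [← integral_inner_partialDeriv_eq_neg hi hji j]
  exact integral_congr_ae (ae_of_all _ fun x => real_inner_self_eq_norm_sq _)

/-- `∫ ‖∑ᵢ ∂ᵢ∂ᵢU‖² = ∑ᵢ ∑ⱼ ∫ ‖∂ⱼ∂ᵢU‖²` (`‖ΔU‖₂ = ‖∇²U‖₂` on the torus; Doering–Gibbon Lemma 6.2,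
Step A (6.2.30)). [cite: DoeringGibbon1995, §6.2 Lemma 6.2, Step A (6.2.30)] (bookkeeping) -/
theorem integral_norm_sq_sum_partialDeriv₂_eq {U : UnitAddTorus d → F'} (hU : IsSmooth U) :
    ∫ x, ‖∑ i, Torus.partialDeriv i (Torus.partialDeriv i U) x‖ ^ 2 =
      ∑ i, ∑ j, ∫ x, ‖Torus.partialDeriv j (Torus.partialDeriv i U) x‖ ^ 2 := by
  have hint : ∀ i j, Integrable (fun x => ⟪Torus.partialDeriv i (Torus.partialDeriv i U) x,
      Torus.partialDeriv j (Torus.partialDeriv j U) x⟫) volume := fun i j =>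
    (((hU.partialDeriv i).partialDeriv i).inner ((hU.partialDeriv j).partialDeriv j)).integrable
  have h1 : ∀ x, ‖∑ i, Torus.partialDeriv i (Torus.partialDeriv i U) x‖ ^ 2 =
      ∑ i, ∑ j, ⟪Torus.partialDeriv i (Torus.partialDeriv i U) x, Torus.partialDeriv j (Torus.partialDeriv j U) x⟫ := by
    intro x
    rw [← real_inner_self_eq_norm_sq, sum_inner]
    exact Finset.sum_congr rfl fun i _ => inner_sum _ _ _
  simp_rw [h1]
  rw [integral_finsetSum _ fun i _ => integrable_finsetSum _ fun j _ => hint i j]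
  refine Finset.sum_congr rfl fun i _ => ?_
  rw [integral_finsetSum _ fun j _ => hint i j]
  exact Finset.sum_congr rfl fun j _ => integral_inner_partialDeriv₂_partialDeriv₂ hU i j

/-- Splitting off the two outer letters: `E_{n+2}(f) = ∑_u ∑ᵢ ∑ⱼ ∫ ‖∂ⱼ ∂ᵢ ∂^u f‖²` (`H_N` of (6.1.2)
with all ordered words). [cite: DoeringGibbon1995, §6.1 (6.1.2)] (bookkeeping) -/
theorem wordEnergy_succ_succ' (n : ℕ) (f : UnitAddTorus d → F') :
    wordEnergy (n + 2) f = ∑ u : Fin n → d, ∑ i, ∑ j,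
      ∫ x, ‖Torus.partialDeriv j (Torus.partialDeriv i (wordDeriv (List.ofFn u) f)) x‖ ^ 2 := by
  rw [wordEnergy_succ', ← (Fin.consEquiv fun _ : Fin (n + 1) => d).sum_comp, Fintype.sum_prod_type, Finset.sum_comm]
  refine Finset.sum_congr rfl fun u _ => Finset.sum_congr rfl fun i _ => Finset.sum_congr rfl fun j _ => ?_
  have : List.ofFn ((Fin.consEquiv fun _ : Fin (n + 1) => d) (i, u)) = i :: List.ofFn u := by
    simp [Fin.consEquiv]
  rw [this, wordDeriv_cons]

/-- **`E_{n+1}(f)² ≤ E_n(f) E_{n+2}(f)`** (Doering–Gibbon (6.2.31), `M_N ≤ M_{N+1}^{1/2} M_{N−1}^{1/2}`: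
integrate by parts once and apply the Cauchy–Schwarz inequality, using `‖ΔU‖₂ = ‖∇²U‖₂`).
[cite: DoeringGibbon1995, §6.2 Lemma 6.2, Step A (6.2.29)–(6.2.31)] -/
theorem wordEnergy_succ_sq_le {f : UnitAddTorus d → F'} (hf : IsSmooth f) (n : ℕ) :
    wordEnergy (n + 1) f ^ 2 ≤ wordEnergy n f * wordEnergy (n + 2) f := by
  have h0 : 0 ≤ wordEnergy n f := wordEnergy_nonneg _ _
  have h2 : 0 ≤ wordEnergy (n + 2) f := wordEnergy_nonneg _ _
  have key : wordEnergy (n + 1) f ≤ Real.sqrt (wordEnergy n f) * Real.sqrt (wordEnergy (n + 2) f) := by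
    -- word by word: `∑ᵢ ∫ ‖∂ᵢU‖² = −∫ ⟪U, ∑ᵢ ∂ᵢ∂ᵢU⟫ ≤ ‖U‖₂ ‖∇²U‖₂`, `U = ∂^u f`
    have hu : ∀ u : Fin n → d,
        ∑ i, ∫ x, ‖Torus.partialDeriv i (wordDeriv (List.ofFn u) f) x‖ ^ 2 ≤
          Real.sqrt (∫ x, ‖wordDeriv (List.ofFn u) f x‖ ^ 2) *
            Real.sqrt (∑ i, ∑ j, ∫ x, ‖Torus.partialDeriv j (Torus.partialDeriv i (wordDeriv (List.ofFn u) f)) x‖ ^ 2) := by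
      intro u
      set U := wordDeriv (List.ofFn u) f with hUdef
      have hU : IsSmooth U := isSmooth_wordDeriv hf _
      have hL : IsSmooth (fun x => ∑ i, Torus.partialDeriv i (Torus.partialDeriv i U) x) :=
        isSmooth_fun_finset_sum _ fun i _ => (hU.partialDeriv i).partialDeriv i
      have hint : ∀ i, Integrable (fun x => ⟪U x, Torus.partialDeriv i (Torus.partialDeriv i U) x⟫) volume :=
        fun i => (hU.inner ((hU.partialDeriv i).partialDeriv i)).integrable
      have e : ∑ i, ∫ x, ‖Torus.partialDeriv i U x‖ ^ 2 =
          -∫ x, ⟪U x, ∑ i, Torus.partialDeriv i (Torus.partialDeriv i U) x⟫ := by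
        simp_rw [inner_sum]
        rw [integral_finsetSum _ fun i _ => hint i, ← Finset.sum_neg_distrib]
        refine Finset.sum_congr rfl fun i _ => ?_
        rw [← integral_inner_partialDeriv_eq_neg hU (hU.partialDeriv i) i]
        exact integral_congr_ae (ae_of_all _ fun x => (real_inner_self_eq_norm_sq _).symm)
      calc ∑ i, ∫ x, ‖Torus.partialDeriv i U x‖ ^ 2
          = -∫ x, ⟪U x, ∑ i, Torus.partialDeriv i (Torus.partialDeriv i U) x⟫ := e
        _ ≤ |∫ x, ⟪U x, ∑ i, Torus.partialDeriv i (Torus.partialDeriv i U) x⟫| := neg_le_abs _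
        _ ≤ Real.sqrt (∫ x, ‖U x‖ ^ 2) *
              Real.sqrt (∫ x, ‖∑ i, Torus.partialDeriv i (Torus.partialDeriv i U) x‖ ^ 2) :=
            abs_integral_inner_le_sqrt_mul_sqrt_of_isSmooth hU hL
        _ = Real.sqrt (∫ x, ‖U x‖ ^ 2) *
              Real.sqrt (∑ i, ∑ j, ∫ x, ‖Torus.partialDeriv j (Torus.partialDeriv i U) x‖ ^ 2) := by
            rw [integral_norm_sq_sum_partialDeriv₂_eq hU]
    rw [wordEnergy_succ' n f]
    calc ∑ u : Fin n → d, ∑ i, ∫ x, ‖Torus.partialDeriv i (wordDeriv (List.ofFn u) f) x‖ ^ 2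
        ≤ ∑ u : Fin n → d, Real.sqrt (∫ x, ‖wordDeriv (List.ofFn u) f x‖ ^ 2) *
            Real.sqrt (∑ i, ∑ j, ∫ x, ‖Torus.partialDeriv j (Torus.partialDeriv i (wordDeriv (List.ofFn u) f)) x‖ ^ 2) :=
          Finset.sum_le_sum fun u _ => hu u
      _ ≤ Real.sqrt (∑ u : Fin n → d, Real.sqrt (∫ x, ‖wordDeriv (List.ofFn u) f x‖ ^ 2) ^ 2) *
            Real.sqrt (∑ u : Fin n → d, Real.sqrt (∑ i, ∑ j,
              ∫ x, ‖Torus.partialDeriv j (Torus.partialDeriv i (wordDeriv (List.ofFn u) f)) x‖ ^ 2) ^ 2) :=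
          Real.sum_mul_le_sqrt_mul_sqrt _ _ _
      _ = Real.sqrt (wordEnergy n f) * Real.sqrt (wordEnergy (n + 2) f) := by
          rw [wordEnergy_succ_succ' n f]
          unfold wordEnergy
          congr 2
          · exact Finset.sum_congr rfl fun u _ => Real.sq_sqrt (integral_nonneg fun _ => sq_nonneg _)
          · exact Finset.sum_congr rfl fun u _ => Real.sq_sqrt (Finset.sum_nonneg fun _ _ =>
              Finset.sum_nonneg fun _ _ => integral_nonneg fun _ => sq_nonneg _)
  calc wordEnergy (n + 1) f ^ 2 ≤ (Real.sqrt (wordEnergy n f) * Real.sqrt (wordEnergy (n + 2) f)) ^ 2 :=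
        pow_le_pow_left₀ (wordEnergy_nonneg _ _) key 2
    _ = wordEnergy n f * wordEnergy (n + 2) f := by
        rw [mul_pow, Real.sq_sqrt h0, Real.sq_sqrt h2]

/-- **Doering–Gibbon's Lemma 6.2, every rung**: `H_N^{r+s} ≤ H_{N−s}^r H_{N+r}^s` for `s ≤ N`
((6.2.28)/(6.2.38): `H_N ≤ H_{N−s}^{r/(r+s)} H_{N+r}^{s/(r+s)}`), for the word energies
`H_N = E_N(f)` of a smooth `f` (discrete log-convexity `pow_le_pow_mul_pow_of_sq_le` from
`wordEnergy_succ_sq_le`, as in Steps B–D of the printed proof).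
[cite: DoeringGibbon1995, §6.2 Lemma 6.2 (6.2.28)–(6.2.38)] -/
theorem wordEnergy_pow_le_pow_mul_pow {f : UnitAddTorus d → F'} (hf : IsSmooth f) {N s : ℕ} (hs : s ≤ N)
    (r : ℕ) : wordEnergy N f ^ (r + s) ≤ wordEnergy (N - s) f ^ r * wordEnergy (N + r) f ^ s := by
  have h := pow_le_pow_mul_pow_of_sq_le (a := fun j => wordEnergy (N - s + j) f)
    (fun j => wordEnergy_nonneg _ _) (r + s)
    (fun j hj1 _ => by
      obtain ⟨k, rfl⟩ : ∃ k, j = k + 1 := ⟨j - 1, by omega⟩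
      have e1 : N - s + (k + 1) = N - s + k + 1 := by omega
      have e2 : N - s + (k + 1 - 1) = N - s + k := by omega
      have e3 : N - s + (k + 1 + 1) = N - s + k + 2 := by omega
      show wordEnergy (N - s + (k + 1)) f ^ 2 ≤ wordEnergy (N - s + (k + 1 - 1)) f * wordEnergy (N - s + (k + 1 + 1)) f
      rw [e1, e2, e3]
      exact wordEnergy_succ_sq_le hf (N - s + k))
    s (by omega)
  have h' : wordEnergy (N - s + s) f ^ (r + s) ≤
      wordEnergy (N - s + 0) f ^ (r + s - s) * wordEnergy (N - s + (r + s)) f ^ s := h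
  have e1 : N - s + s = N := Nat.sub_add_cancel hs
  have e2 : r + s - s = r := Nat.add_sub_cancel r s
  have e3 : N - s + (r + s) = N + r := by omega
  rw [e1, add_zero, e2, e3] at h'
  exact h'

/-- **The ladder inequality in the form (6.2.39)**:
`½ Ḣ_N ≤ −ν H_N^{1+1/s} / H_{N−s}^{1/s} + c_N ‖Du‖_∞ H_N + H_N^{1/2} Φ_N^{1/2}`, `1 ≤ s ≤ N`
(from (6.2.27) and Lemma 6.2 with `r = 1`), with the same constant as `exists_ladder_inequality`,
for `ν ≥ 0` and at times where `H_{N−s} = E_{N−s}(u(t)) > 0`.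
[cite: DoeringGibbon1995, Thm 6.1, §6.2 (6.2.39)] -/
theorem exists_ladder_inequality_rpow (d : Type*) [Fintype d] [DecidableEq d] (N : ℕ) :
    ∃ c : ℝ, 0 ≤ c ∧ ∀ {a b ν : ℝ} {f u : ℝ → UnitAddTorus d → EuclideanSpace ℝ d} {p : ℝ → UnitAddTorus d → ℝ},
      Torus.IsClassicalNSSolutionOn (Icc a b) ν f u p → a < b → 0 ≤ ν → ∀ {t : ℝ}, t ∈ Icc a b → ∀ M : ℝ, 0 ≤ M →
        (∀ x, ∑ i, ‖Torus.partialDeriv i (u t) x‖ ^ 2 ≤ M ^ 2) → ∀ {s : ℕ}, 1 ≤ s → s ≤ N →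
        0 < wordEnergy (N - s) (u t) →
        derivWithin (fun s => 2⁻¹ * wordEnergy N (u s)) (Icc a b) t ≤
          -ν * (wordEnergy N (u t) ^ (1 + 1 / (s : ℝ)) / wordEnergy (N - s) (u t) ^ (1 / (s : ℝ))) +
            c * M * wordEnergy N (u t) + Real.sqrt (wordEnergy N (u t)) * Real.sqrt (wordEnergy N (f t)) := by
  obtain ⟨c, hc0, hc⟩ := exists_ladder_inequality d N
  refine ⟨c, hc0, fun {a b ν f u p} h hab hν t ht M hM0 hM s hs1 hsN hpos => ?_⟩
  have hut : IsSmooth (u t) := h.smooth_velocity.isSmooth_slice ht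
  have h1 := hc h hab ht M hM0 hM
  -- Lemma 6.2 with `r = 1`: `E_N^{1+s} ≤ E_{N−s} E_{N+1}^s`, then `1/s`-th roots
  have hL := wordEnergy_pow_le_pow_mul_pow hut hsN 1
  rw [pow_one] at hL
  have hEN : 0 ≤ wordEnergy N (u t) := wordEnergy_nonneg _ _
  have hEN1 : 0 ≤ wordEnergy (N + 1) (u t) := wordEnergy_nonneg _ _
  have hs0 : (0 : ℝ) < s := by exact_mod_cast hs1
  have hroot : wordEnergy N (u t) ^ (1 + 1 / (s : ℝ)) ≤
      wordEnergy (N - s) (u t) ^ (1 / (s : ℝ)) * wordEnergy (N + 1) (u t) := by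
    have h2 := Real.rpow_le_rpow (pow_nonneg hEN _) hL (le_of_lt (one_div_pos.2 hs0))
    rw [Real.mul_rpow hpos.le (pow_nonneg hEN1 _), ← Real.rpow_natCast, ← Real.rpow_natCast,
      ← Real.rpow_mul hEN, ← Real.rpow_mul hEN1] at h2
    have e1 : ((1 + s : ℕ) : ℝ) * (1 / (s : ℝ)) = 1 + 1 / (s : ℝ) := by
      push_cast
      field_simp
      ring
    have e2 : ((s : ℕ) : ℝ) * (1 / (s : ℝ)) = 1 := by
      field_simp
    rwa [e1, e2, Real.rpow_one] at h2
  have hX : wordEnergy N (u t) ^ (1 + 1 / (s : ℝ)) / wordEnergy (N - s) (u t) ^ (1 / (s : ℝ)) ≤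
      wordEnergy (N + 1) (u t) := by
    rw [div_le_iff₀ (Real.rpow_pos_of_pos hpos _), mul_comm]
    exact hroot
  have hvisc : -ν * wordEnergy (N + 1) (u t) ≤
      -ν * (wordEnergy N (u t) ^ (1 + 1 / (s : ℝ)) / wordEnergy (N - s) (u t) ^ (1 / (s : ℝ))) :=
    mul_le_mul_of_nonpos_left hX (neg_nonpos.2 hν)
  linarith



/-! ## Grönwall against the time integral of `‖∇u‖_∞` -/

/-- **Every-rung Grönwall control by the time integral of `‖∇u‖_∞`** (Majda–Bertozzi 2002, §3.3,
proof of Thm 3.6: `d/dt ‖v‖_m ≤ c_m |∇v|_{L^∞} ‖v‖_m`, hence (3.79)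
`‖v(T)‖_m ≤ ‖v₀‖_m exp(∫₀ᵀ c_m |∇v|_{L^∞})`; rung by rung, i.e. (6.2.27) integrated with the viscous
term dropped): with the constant `c = c(card d, N)` of `exists_ladder_inequality`, for every classical
solution of the unforced Navier–Stokes system with `ν ≥ 0` (Euler included) on `T^d × [a, b]`,
`a < b`, every `M : ℝ → ℝ` continuous and nonnegative on `[a, b]` with `∑ᵢ ‖∂ᵢu(s, x)‖² ≤ M(s)²`
for all `s ∈ [a, b]` and all `x`, and every `t ∈ [a, b]`,
`E_N(u(t)) ≤ E_N(u(a)) · exp(2c ∫ₐᵗ M)`. The rung `N = 2` with the explicit `2c₂ = 6` is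
`TorusPalinstrophyGronwall`. [cite: MajdaBertozziCUP2002, §3.3, proof of Thm 3.6, eq. (3.79)] -/
theorem exists_wordEnergy_le_mul_exp_integral (d : Type*) [Fintype d] [DecidableEq d] (N : ℕ) :
    ∃ c : ℝ, 0 ≤ c ∧ ∀ {a b ν : ℝ} {u : ℝ → UnitAddTorus d → EuclideanSpace ℝ d} {p : ℝ → UnitAddTorus d → ℝ},
      Torus.IsClassicalNSSolutionOn (Icc a b) ν (fun _ _ => 0) u p → a < b → 0 ≤ ν → ∀ {M : ℝ → ℝ},
        ContinuousOn M (Icc a b) → (∀ s ∈ Icc a b, 0 ≤ M s) →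
        (∀ s ∈ Icc a b, ∀ x, ∑ i, ‖Torus.partialDeriv i (u s) x‖ ^ 2 ≤ M s ^ 2) →
        ∀ {t : ℝ}, t ∈ Icc a b →
          wordEnergy N (u t) ≤ wordEnergy N (u a) * Real.exp (2 * c * ∫ s in a..t, M s) := by
  obtain ⟨c, hc0, hc⟩ := exists_abs_ladderNonlinear_le d N
  refine ⟨c, hc0, fun {a b ν u p} h hab hν M hMc hM0 hM t ht => ?_⟩
  set F : ℝ → ℝ := fun r => 2⁻¹ * wordEnergy N (u r) with hF
  -- `F` is differentiable within `[a, b]` (the `H_N` balance)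
  have hder : ∀ s ∈ Icc a b, HasDerivWithinAt F
      (-ν * wordEnergy (N + 1) (u s) - ladderNonlinear N (u s) +
        wordForcing N (fun _ => (0 : EuclideanSpace ℝ d)) (u s)) (Icc a b) s :=
    fun s hs => h.hasDerivWithinAt_half_wordEnergy hab N hs
  -- the rung: `F' ≤ (2 c M) F`
  have hle : ∀ s ∈ Icc a b,
      -ν * wordEnergy (N + 1) (u s) - ladderNonlinear N (u s) +
        wordForcing N (fun _ => (0 : EuclideanSpace ℝ d)) (u s) ≤ (2 * c * M s) * F s := by
    intro s hs
    have hus : IsSmooth (u s) := h.smooth_velocity.isSmooth_slice hs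
    have h1 := hc (u s) hus (h.divFree s hs) (M s) (hM0 s hs) (hM s hs)
    have hF0 : wordForcing N (fun _ => (0 : EuclideanSpace ℝ d)) (u s) = 0 := by
      unfold wordForcing
      refine Finset.sum_eq_zero fun w _ => ?_
      rw [wordDeriv_zero]
      simp
    have hE1 : 0 ≤ wordEnergy (N + 1) (u s) := wordEnergy_nonneg _ _
    have e : (2 * c * M s) * F s = c * M s * wordEnergy N (u s) := by rw [hF]; ring
    rw [hF0, e]
    nlinarith [neg_abs_le (ladderNonlinear N (u s)), mul_nonneg hν hE1]
  have hk : ContinuousOn (fun s => 2 * c * M s) (Icc a b) := continuousOn_const.mul hMc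
  have hmain := le_mul_exp_integral_of_hasDerivWithinAt_le_mul hab hder hk hle ht
  rw [intervalIntegral.integral_const_mul] at hmain
  have e : ∀ r, wordEnergy N (u r) = 2 * F r := fun r => by rw [hF]; ring
  rw [e t, e a, mul_assoc]
  exact mul_le_mul_of_nonneg_left hmain (by norm_num)


/-! ## The `F_N` ladder: Theorem 6.1 as stated (time-independent forcing with a spectral cutoff) -/

/-- `F_N = H_N + τ² Φ_N` ((6.2.3)), `τ = L² ν⁻¹` the viscous time of the box; on the unit torus `L = 1`,
`τ = ν⁻¹`: `ladderF ν N g v = E_N(v) + ν⁻² E_N(g)`. [cite: DoeringGibbon1995, §6.2 (6.2.3)] -/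
def ladderF (ν : ℝ) (N : ℕ) (g v : UnitAddTorus d → EuclideanSpace ℝ d) : ℝ :=
  wordEnergy N v + ν⁻¹ ^ 2 * wordEnergy N g

omit [Fintype d] [DecidableEq d] in
/-- Sums of log-convex nonnegative triples are log-convex — Step 8's "(s+1)-th roots, sum over the six
components, Hölder–Schwarz" ((6.2.44)–(6.2.46)) in sequence form: `x² ≤ x₀x₁`, `y² ≤ y₀y₁` with
`x₀, x₁, y₀, y₁ ≥ 0` give `(x + y)² ≤ (x₀ + y₀)(x₁ + y₁)`. [cite: DoeringGibbon1995, §6.2 Step 8 (6.2.44)–(6.2.46)] (bookkeeping) -/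
theorem add_sq_le_add_mul_add {x x₀ x₁ y y₀ y₁ : ℝ} (hx₀ : 0 ≤ x₀) (hx₁ : 0 ≤ x₁) (hy₀ : 0 ≤ y₀)
    (hy₁ : 0 ≤ y₁) (hxx : x ^ 2 ≤ x₀ * x₁) (hyy : y ^ 2 ≤ y₀ * y₁) :
    (x + y) ^ 2 ≤ (x₀ + y₀) * (x₁ + y₁) := by
  have hxy : x * y ≤ (x₀ * y₁ + y₀ * x₁) / 2 := by
    have h1 : (x * y) ^ 2 ≤ ((x₀ * y₁ + y₀ * x₁) / 2) ^ 2 := by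
      calc (x * y) ^ 2 = x ^ 2 * y ^ 2 := by ring
        _ ≤ (x₀ * x₁) * (y₀ * y₁) := mul_le_mul hxx hyy (sq_nonneg _) (mul_nonneg hx₀ hx₁)
        _ ≤ ((x₀ * y₁ + y₀ * x₁) / 2) ^ 2 := by nlinarith [sq_nonneg (x₀ * y₁ - y₀ * x₁)]
    exact le_of_pow_le_pow_left₀ two_ne_zero (by positivity) h1
  nlinarith

/-- **Lemma 6.3, every rung** ((6.2.46): `F_N ≤ F_{N−s}^{1/(1+s)} F_{N+1}^{s/(1+s)}`, printed with `F_{N−1}`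
for `F_{N+1}`; here with a general `r` as in Lemma 6.2): `F_N^{r+s} ≤ F_{N−s}^r F_{N+r}^s` for `s ≤ N` and
smooth `g, v` (each of `E_·(v)`, `ν⁻²E_·(g)` is log-convex by `wordEnergy_succ_sq_le`, hence so is their
sum, then `pow_le_pow_mul_pow_of_sq_le`). [cite: DoeringGibbon1995, §6.2 Lemma 6.3 (6.2.44)–(6.2.46)] -/
theorem ladderF_pow_le_pow_mul_pow {g v : UnitAddTorus d → EuclideanSpace ℝ d} (hg : IsSmooth g) (hv : IsSmooth v)
    (ν : ℝ) {N s : ℕ} (hs : s ≤ N) (r : ℕ) :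
    ladderF ν N g v ^ (r + s) ≤ ladderF ν (N - s) g v ^ r * ladderF ν (N + r) g v ^ s := by
  have hw : 0 ≤ ν⁻¹ ^ 2 := sq_nonneg _
  have h := pow_le_pow_mul_pow_of_sq_le (a := fun j => ladderF ν (N - s + j) g v)
    (fun j => add_nonneg (wordEnergy_nonneg _ _) (mul_nonneg hw (wordEnergy_nonneg _ _))) (r + s)
    (fun j hj1 _ => by
      obtain ⟨k, rfl⟩ : ∃ k, j = k + 1 := ⟨j - 1, by omega⟩
      have e1 : N - s + (k + 1) = N - s + k + 1 := by omega
      have e2 : N - s + (k + 1 - 1) = N - s + k := by omega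
      have e3 : N - s + (k + 1 + 1) = N - s + k + 2 := by omega
      show ladderF ν (N - s + (k + 1)) g v ^ 2 ≤
        ladderF ν (N - s + (k + 1 - 1)) g v * ladderF ν (N - s + (k + 1 + 1)) g v
      rw [e1, e2, e3]
      unfold ladderF
      refine add_sq_le_add_mul_add (wordEnergy_nonneg _ _) (wordEnergy_nonneg _ _)
        (mul_nonneg hw (wordEnergy_nonneg _ _)) (mul_nonneg hw (wordEnergy_nonneg _ _))
        (wordEnergy_succ_sq_le hv (N - s + k)) ?_
      have h2 := wordEnergy_succ_sq_le hg (N - s + k)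
      calc (ν⁻¹ ^ 2 * wordEnergy (N - s + k + 1) g) ^ 2 = (ν⁻¹ ^ 2) ^ 2 * wordEnergy (N - s + k + 1) g ^ 2 := by ring
        _ ≤ (ν⁻¹ ^ 2) ^ 2 * (wordEnergy (N - s + k) g * wordEnergy (N - s + k + 2) g) :=
            mul_le_mul_of_nonneg_left h2 (sq_nonneg _)
        _ = ν⁻¹ ^ 2 * wordEnergy (N - s + k) g * (ν⁻¹ ^ 2 * wordEnergy (N - s + k + 2) g) := by ring)
    s (by omega)
  have h' : ladderF ν (N - s + s) g v ^ (r + s) ≤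
      ladderF ν (N - s + 0) g v ^ (r + s - s) * ladderF ν (N - s + (r + s)) g v ^ s := h
  have e1 : N - s + s = N := Nat.sub_add_cancel hs
  have e2 : r + s - s = r := Nat.add_sub_cancel r s
  have e3 : N - s + (r + s) = N + r := by omega
  rw [e1, add_zero, e2, e3] at h'
  exact h'

/-- **Doering–Gibbon's ladder theorem, Thm 6.1: the two-sided `F_N`-inequality (6.2.43)/(6.2.6), every
rung, any dimension.** For a TIME-INDEPENDENT smooth forcing `f` with a spectral cutoff at rung `N`,
`Φ_{N+1} ≤ Λ Φ_N` (`Λ = λ_f⁻² ≥ 0`, (6.2.2)), on the unit torus (`L = 1`, `τ = ν⁻¹`,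
`λ₀⁻² = λ_f⁻² + L⁻² = Λ + 1`, (6.2.4)) and `ν > 0`: there is `c = c(card d, N) ≥ 0` such that along
every classical solution on `T^d × [a, b]`, `a < b`, at every `t ∈ [a, b]` with `∑ᵢ ‖∂ᵢu(t, x)‖² ≤ M²`
for all `x` (`M ≥ 0`), the one-sided derivative `D = d/dt ½F_N` within `[a, b]` satisfies
`−ν F_{N+1} − (c M + ν(Λ+1)) F_N ≤ D ≤ −ν F_{N+1} + (c M + ν(Λ+1)) F_N`
(Steps 7 and 9: (6.2.40)–(6.2.43), (6.2.47)–(6.2.48); `F_N = ladderF ν N f (u t)`).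
[cite: DoeringGibbon1995, Thm 6.1 (6.2.6), §6.2 (6.2.40)–(6.2.43), (6.2.47)–(6.2.48)] -/
theorem exists_ladderF_inequality (d : Type*) [Fintype d] [DecidableEq d] (N : ℕ) :
    ∃ c : ℝ, 0 ≤ c ∧ ∀ {a b ν : ℝ} {f : UnitAddTorus d → EuclideanSpace ℝ d} {u : ℝ → UnitAddTorus d → EuclideanSpace ℝ d}
      {p : ℝ → UnitAddTorus d → ℝ}, Torus.IsClassicalNSSolutionOn (Icc a b) ν (fun _ => f) u p → a < b → 0 < ν →
      ∀ {Λ : ℝ}, 0 ≤ Λ → wordEnergy (N + 1) f ≤ Λ * wordEnergy N f → ∀ {t : ℝ}, t ∈ Icc a b → ∀ M : ℝ, 0 ≤ M →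
        (∀ x, ∑ i, ‖Torus.partialDeriv i (u t) x‖ ^ 2 ≤ M ^ 2) →
        -ν * ladderF ν (N + 1) f (u t) - (c * M + ν * (Λ + 1)) * ladderF ν N f (u t) ≤
            derivWithin (fun s => 2⁻¹ * ladderF ν N f (u s)) (Icc a b) t ∧
          derivWithin (fun s => 2⁻¹ * ladderF ν N f (u s)) (Icc a b) t ≤
            -ν * ladderF ν (N + 1) f (u t) + (c * M + ν * (Λ + 1)) * ladderF ν N f (u t) := by
  obtain ⟨c, hc0, hc⟩ := exists_abs_ladderNonlinear_le d N
  refine ⟨c, hc0, fun {a b ν f u p} h hab hν Λ hΛ hcut t ht M hM0 hM => ?_⟩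
  have hut : IsSmooth (u t) := h.smooth_velocity.isSmooth_slice ht
  have hft : IsSmooth f := isSmooth_force_slice h hab ht
  -- the derivative of `½F_N` is that of `½E_N(u)` (the forcing is time independent)
  have hfun : (fun s => 2⁻¹ * ladderF ν N f (u s)) =
      fun s => 2⁻¹ * wordEnergy N (u s) + 2⁻¹ * (ν⁻¹ ^ 2 * wordEnergy N f) := by
    funext s; unfold ladderF; ring
  have hderiv : HasDerivWithinAt (fun s => 2⁻¹ * ladderF ν N f (u s))
      (-ν * wordEnergy (N + 1) (u t) - ladderNonlinear N (u t) + wordForcing N f (u t)) (Icc a b) t := by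
    rw [hfun]
    exact (h.hasDerivWithinAt_half_wordEnergy hab N ht).add_const _
  rw [hderiv.derivWithin (uniqueDiffOn_Icc hab t ht)]
  -- the three estimates
  have hNL := hc (u t) hut (h.divFree t ht) M hM0 hM
  have hWF := abs_wordForcing_le hft hut N
  have hEN : 0 ≤ wordEnergy N (u t) := wordEnergy_nonneg _ _
  have hEN1 : 0 ≤ wordEnergy (N + 1) (u t) := wordEnergy_nonneg _ _
  have hΦN : 0 ≤ wordEnergy N f := wordEnergy_nonneg _ _
  have hΦN1 : 0 ≤ wordEnergy (N + 1) f := wordEnergy_nonneg _ _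
  have hF0 : 0 ≤ ladderF ν N f (u t) := add_nonneg hEN (mul_nonneg (sq_nonneg _) hΦN)
  have hEF : wordEnergy N (u t) ≤ ladderF ν N f (u t) := le_add_of_nonneg_right (mul_nonneg (sq_nonneg _) hΦN)
  have hΦF : wordEnergy N f ≤ ν ^ 2 * ladderF ν N f (u t) := by
    have hν2 : ν ^ 2 * (ν⁻¹ ^ 2 * wordEnergy N f) = wordEnergy N f := by field_simp
    unfold ladderF
    nlinarith [mul_nonneg (sq_nonneg ν) hEN]
  -- forcing: `√E_N √Φ_N ≤ ν F_N`
  have hforce : Real.sqrt (wordEnergy N (u t)) * Real.sqrt (wordEnergy N f) ≤ ν * ladderF ν N f (u t) := by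
    calc Real.sqrt (wordEnergy N (u t)) * Real.sqrt (wordEnergy N f)
        ≤ Real.sqrt (ladderF ν N f (u t)) * Real.sqrt (ν ^ 2 * ladderF ν N f (u t)) :=
          mul_le_mul (Real.sqrt_le_sqrt hEF) (Real.sqrt_le_sqrt hΦF) (Real.sqrt_nonneg _) (Real.sqrt_nonneg _)
      _ = ν * ladderF ν N f (u t) := by
          rw [Real.sqrt_mul (sq_nonneg ν), Real.sqrt_sq hν.le, mul_left_comm, Real.mul_self_sqrt hF0]
  -- cutoff: `ν ν⁻² Φ_{N+1} ≤ ν Λ F_N`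
  have hcut' : ν * (ν⁻¹ ^ 2 * wordEnergy (N + 1) f) ≤ ν * Λ * ladderF ν N f (u t) := by
    have h1 : ν⁻¹ ^ 2 * wordEnergy (N + 1) f ≤ Λ * (ν⁻¹ ^ 2 * wordEnergy N f) := by
      nlinarith [sq_nonneg ν⁻¹, mul_le_mul_of_nonneg_left hcut (sq_nonneg ν⁻¹)]
    have h2 : ν⁻¹ ^ 2 * wordEnergy N f ≤ ladderF ν N f (u t) := le_add_of_nonneg_left hEN
    nlinarith [mul_le_mul_of_nonneg_left h2 hΛ]
  have hvisc : -ν * wordEnergy (N + 1) (u t) = -ν * ladderF ν (N + 1) f (u t) + ν * (ν⁻¹ ^ 2 * wordEnergy (N + 1) f) := by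
    unfold ladderF; ring
  have hcM : c * M * wordEnergy N (u t) ≤ c * M * ladderF ν N f (u t) :=
    mul_le_mul_of_nonneg_left hEF (mul_nonneg hc0 hM0)
  have hνΛF : 0 ≤ ν * Λ * ladderF ν N f (u t) := mul_nonneg (mul_nonneg hν.le hΛ) hF0
  have hpos : 0 ≤ ν * (ν⁻¹ ^ 2 * wordEnergy (N + 1) f) := mul_nonneg hν.le (mul_nonneg (sq_nonneg _) hΦN1)
  have hNL1 := neg_abs_le (ladderNonlinear N (u t))
  have hNL2 := le_abs_self (ladderNonlinear N (u t))
  have hWF1 := neg_abs_le (wordForcing N f (u t))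
  have hWF2 := le_abs_self (wordForcing N f (u t))
  have hexp : (c * M + ν * (Λ + 1)) * ladderF ν N f (u t) =
      c * M * ladderF ν N f (u t) + ν * Λ * ladderF ν N f (u t) + ν * ladderF ν N f (u t) := by ring
  constructor
  · -- lower bound (6.2.47)–(6.2.48)
    rw [hexp]
    linarith
  · -- upper bound (6.2.40)–(6.2.43)
    rw [hexp]
    linarith

/-- **Doering–Gibbon's ladder theorem, Thm 6.1 (6.2.5), every rung, any dimension**: under the
hypotheses of `exists_ladderF_inequality` and `1 ≤ s ≤ N`, at times where `F_{N−s} > 0`,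
`½ Ḟ_N ≤ −ν F_N^{1+1/s} / F_{N−s}^{1/s} + (c_N ‖Du‖_∞ + ν λ₀⁻²) F_N` (from (6.2.43) and Lemma 6.3 with
`r = 1`). [cite: DoeringGibbon1995, Thm 6.1 (6.2.5)] -/
theorem exists_ladderF_inequality_rpow (d : Type*) [Fintype d] [DecidableEq d] (N : ℕ) :
    ∃ c : ℝ, 0 ≤ c ∧ ∀ {a b ν : ℝ} {f : UnitAddTorus d → EuclideanSpace ℝ d} {u : ℝ → UnitAddTorus d → EuclideanSpace ℝ d}
      {p : ℝ → UnitAddTorus d → ℝ}, Torus.IsClassicalNSSolutionOn (Icc a b) ν (fun _ => f) u p → a < b → 0 < ν →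
      ∀ {Λ : ℝ}, 0 ≤ Λ → wordEnergy (N + 1) f ≤ Λ * wordEnergy N f → ∀ {t : ℝ}, t ∈ Icc a b → ∀ M : ℝ, 0 ≤ M →
        (∀ x, ∑ i, ‖Torus.partialDeriv i (u t) x‖ ^ 2 ≤ M ^ 2) → ∀ {s : ℕ}, 1 ≤ s → s ≤ N →
        0 < ladderF ν (N - s) f (u t) →
          derivWithin (fun s => 2⁻¹ * ladderF ν N f (u s)) (Icc a b) t ≤
            -ν * (ladderF ν N f (u t) ^ (1 + 1 / (s : ℝ)) / ladderF ν (N - s) f (u t) ^ (1 / (s : ℝ))) +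
              (c * M + ν * (Λ + 1)) * ladderF ν N f (u t) := by
  obtain ⟨c, hc0, hc⟩ := exists_ladderF_inequality d N
  refine ⟨c, hc0, fun {a b ν f u p} h hab hν Λ hΛ hcut t ht M hM0 hM s hs1 hsN hpos => ?_⟩
  have hut : IsSmooth (u t) := h.smooth_velocity.isSmooth_slice ht
  have hft : IsSmooth f := isSmooth_force_slice h hab ht
  have h1 := (hc h hab hν hΛ hcut ht M hM0 hM).2
  -- Lemma 6.3 with `r = 1`, then `1/s`-th roots
  have hL := ladderF_pow_le_pow_mul_pow hft hut ν hsN 1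
  rw [pow_one] at hL
  have hFN : 0 ≤ ladderF ν N f (u t) :=
    add_nonneg (wordEnergy_nonneg _ _) (mul_nonneg (sq_nonneg _) (wordEnergy_nonneg _ _))
  have hFN1 : 0 ≤ ladderF ν (N + 1) f (u t) :=
    add_nonneg (wordEnergy_nonneg _ _) (mul_nonneg (sq_nonneg _) (wordEnergy_nonneg _ _))
  have hs0 : (0 : ℝ) < s := by exact_mod_cast hs1
  have hroot : ladderF ν N f (u t) ^ (1 + 1 / (s : ℝ)) ≤
      ladderF ν (N - s) f (u t) ^ (1 / (s : ℝ)) * ladderF ν (N + 1) f (u t) := by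
    have h2 := Real.rpow_le_rpow (pow_nonneg hFN _) hL (le_of_lt (one_div_pos.2 hs0))
    rw [Real.mul_rpow hpos.le (pow_nonneg hFN1 _), ← Real.rpow_natCast, ← Real.rpow_natCast,
      ← Real.rpow_mul hFN, ← Real.rpow_mul hFN1] at h2
    have e1 : ((1 + s : ℕ) : ℝ) * (1 / (s : ℝ)) = 1 + 1 / (s : ℝ) := by
      push_cast
      field_simp
      ring
    have e2 : ((s : ℕ) : ℝ) * (1 / (s : ℝ)) = 1 := by
      field_simp
    rwa [e1, e2, Real.rpow_one] at h2
  have hX : ladderF ν N f (u t) ^ (1 + 1 / (s : ℝ)) / ladderF ν (N - s) f (u t) ^ (1 / (s : ℝ)) ≤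
      ladderF ν (N + 1) f (u t) := by
    rw [div_le_iff₀ (Real.rpow_pos_of_pos hpos _), mul_comm]
    exact hroot
  have hvisc : -ν * ladderF ν (N + 1) f (u t) ≤
      -ν * (ladderF ν N f (u t) ^ (1 + 1 / (s : ℝ)) / ladderF ν (N - s) f (u t) ^ (1 / (s : ℝ))) :=
    mul_le_mul_of_nonpos_left hX (neg_nonpos.2 hν.le)
  linarith


/-! ## Theorem 6.2 over a finite window: the dynamical wavenumbers `κ²_{N,r} = (F_N/F_r)^{1/(N−r)}` -/

/-- Primitives of functions continuous on `[a, b]` are differentiable within `[a, b]`. [folklore] -/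
private theorem hasDerivWithinAt_primitive {a b : ℝ} {k : ℝ → ℝ} (hk : ContinuousOn k (Icc a b)) {τ : ℝ}
    (hτ : τ ∈ Icc a b) : HasDerivWithinAt (fun σ => ∫ r in a..σ, k r) (k τ) (Icc a b) τ := by
  haveI : Fact (τ ∈ Icc a b) := ⟨hτ⟩
  have hint : IntervalIntegrable k volume a τ :=
    (hk.mono (Icc_subset_Icc_right hτ.2)).intervalIntegrable_of_Icc hτ.1
  exact intervalIntegral.integral_hasDerivWithinAt_right hint
    (hk.stronglyMeasurableAtFilter_nhdsWithin measurableSet_Icc τ) (hk τ hτ)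

/-- A nondegenerate forcing at rung `N` is nondegenerate at every lower rung: `E_N(g) > 0 ⇒ E_k(g) > 0`
for `k ≤ N` (`E_{k+1}² ≤ E_k E_{k+2}`). [cite: DoeringGibbon1995, §6.2 Lemma 6.2, Step A (6.2.31)]
(bookkeeping) -/
theorem wordEnergy_pos_of_le {g : UnitAddTorus d → F'} (hg : IsSmooth g) {N k : ℕ} (hk : k ≤ N)
    (hN : 0 < wordEnergy N g) : 0 < wordEnergy k g := by
  by_contra hneg
  have hz : wordEnergy k g = 0 := le_antisymm (not_lt.1 hneg) (wordEnergy_nonneg _ _)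
  -- `E_{k+j} = 0` and `E_{k+j+1} = 0` for every `j`, by induction
  have hall : ∀ j, wordEnergy (k + j) g = 0 ∧ wordEnergy (k + j + 1) g = 0 := by
    intro j
    induction j with
    | zero =>
        refine ⟨hz, ?_⟩
        have h := wordEnergy_succ_sq_le hg k
        rw [hz, zero_mul] at h
        exact pow_eq_zero_iff two_ne_zero |>.1 (le_antisymm h (sq_nonneg _))
    | succ j ih =>
        refine ⟨ih.2, ?_⟩
        have h := wordEnergy_succ_sq_le hg (k + j + 1)
        rw [ih.2, zero_mul] at h
        exact pow_eq_zero_iff two_ne_zero |>.1 (le_antisymm h (sq_nonneg _))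
  obtain ⟨j, rfl⟩ : ∃ j, N = k + j := ⟨N - k, by omega⟩
  exact absurd (hall j).1 hN.ne'

/-- **Doering–Gibbon Thm 6.2 over a finite time window** ((6.4.1): divide (6.2.5) by `F_N` and
integrate; the long-time average (6.3.10) of the printed statement (6.4.3),
`⟨κ²_{N,r}⟩ ≤ c_N ν⁻¹ ⟨‖Du‖_∞⟩ + λ₀⁻²`, is this inequality divided by `b − a` in the limit): under
the hypotheses of `exists_ladderF_inequality` with a forcing nondegenerate at rung `N` (`Φ_N > 0`,
cf. (6.4.2)), a continuous majorant `∑ᵢ ‖∂ᵢu(τ, x)‖² ≤ M(τ)²` on `[a, b]` and `1 ≤ s ≤ N` (`r = N − s`),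
`(2ν)⁻¹ (log F_N(b) − log F_N(a)) + ∫ₐᵇ (F_N/F_{N−s})^{1/s} ≤ c ν⁻¹ ∫ₐᵇ M + (Λ + 1)(b − a)`
(`κ²_{N,N−s} = (F_N/F_{N−s})^{1/s}`, `λ₀⁻² = Λ + 1` on the unit torus).
[cite: DoeringGibbon1995, Thm 6.2, §6.4 (6.4.1)–(6.4.3)] -/
theorem exists_log_ladderF_add_integral_wavenumber_le (d : Type*) [Fintype d] [DecidableEq d] (N : ℕ) :
    ∃ c : ℝ, 0 ≤ c ∧ ∀ {a b ν : ℝ} {f : UnitAddTorus d → EuclideanSpace ℝ d} {u : ℝ → UnitAddTorus d → EuclideanSpace ℝ d}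
      {p : ℝ → UnitAddTorus d → ℝ}, Torus.IsClassicalNSSolutionOn (Icc a b) ν (fun _ => f) u p → a < b → 0 < ν →
      ∀ {Λ : ℝ}, 0 ≤ Λ → wordEnergy (N + 1) f ≤ Λ * wordEnergy N f → 0 < wordEnergy N f →
      ∀ {M : ℝ → ℝ}, ContinuousOn M (Icc a b) → (∀ τ ∈ Icc a b, 0 ≤ M τ) →
        (∀ τ ∈ Icc a b, ∀ x, ∑ i, ‖Torus.partialDeriv i (u τ) x‖ ^ 2 ≤ M τ ^ 2) → ∀ {s : ℕ}, 1 ≤ s → s ≤ N →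
        (2 * ν)⁻¹ * (Real.log (ladderF ν N f (u b)) - Real.log (ladderF ν N f (u a))) +
            ∫ τ in a..b, (ladderF ν N f (u τ) / ladderF ν (N - s) f (u τ)) ^ (1 / (s : ℝ)) ≤
          c * ν⁻¹ * (∫ τ in a..b, M τ) + (Λ + 1) * (b - a) := by
  obtain ⟨c, hc0, hc⟩ := exists_ladderF_inequality_rpow d N
  refine ⟨c, hc0, fun {a b ν f u p} h hab hν Λ hΛ hcut hΦ M hMc hM0 hM s hs1 hsN => ?_⟩
  set S : Set ℝ := Icc a b with hSdef
  have hbS : b ∈ S := right_mem_Icc.2 hab.le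
  have hft : IsSmooth f := isSmooth_force_slice h hab hbS
  have hs0 : (0 : ℝ) < s := by exact_mod_cast hs1
  have hexp0 : 0 ≤ 1 / (s : ℝ) := le_of_lt (one_div_pos.2 hs0)
  -- positivity of `F_k(τ)`, `k ≤ N`
  have hFpos : ∀ k, k ≤ N → ∀ τ, 0 < ladderF ν k f (u τ) := fun k hk τ =>
    add_pos_of_nonneg_of_pos (wordEnergy_nonneg _ _)
      (mul_pos (pow_pos (inv_pos.2 hν) 2) (wordEnergy_pos_of_le hft hk hΦ))
  -- the functions of time
  set F : ℝ → ℝ := fun τ => ladderF ν N f (u τ) with hFdef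
  set Fr : ℝ → ℝ := fun τ => ladderF ν (N - s) f (u τ) with hFrdef
  set κ : ℝ → ℝ := fun τ => (F τ / Fr τ) ^ (1 / (s : ℝ)) with hκdef
  set v : ℕ → ℝ → ℝ := fun n τ =>
    -ν * wordEnergy (n + 1) (u τ) - ladderNonlinear n (u τ) + wordForcing n f (u τ) with hvdef
  -- derivatives of `F_n(u τ)` within `[a, b]`
  have hderF : ∀ n, ∀ τ ∈ S, HasDerivWithinAt (fun σ => ladderF ν n f (u σ)) (2 * v n τ) S τ := by
    intro n τ hτ
    have h1 := ((h.hasDerivWithinAt_half_wordEnergy hab n hτ).add_const (2⁻¹ * (ν⁻¹ ^ 2 * wordEnergy n f))).const_mul 2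
    have hfun : (fun σ => ladderF ν n f (u σ)) =
        fun σ => 2 * (2⁻¹ * wordEnergy n (u σ) + 2⁻¹ * (ν⁻¹ ^ 2 * wordEnergy n f)) := by
      funext σ; unfold ladderF; ring
    rw [hfun]
    exact h1
  have hhalf : ∀ τ ∈ S, derivWithin (fun σ => 2⁻¹ * ladderF ν N f (u σ)) S τ = v N τ := by
    intro τ hτ
    have h1 := (h.hasDerivWithinAt_half_wordEnergy hab N hτ).add_const (2⁻¹ * (ν⁻¹ ^ 2 * wordEnergy N f))
    have hfun : (fun σ => 2⁻¹ * ladderF ν N f (u σ)) =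
        fun σ => 2⁻¹ * wordEnergy N (u σ) + 2⁻¹ * (ν⁻¹ ^ 2 * wordEnergy N f) := by
      funext σ; unfold ladderF; ring
    rw [hfun]
    exact h1.derivWithin (uniqueDiffOn_Icc hab τ hτ)
  have hFc : ContinuousOn F S := fun τ hτ => (hderF N τ hτ).continuousWithinAt
  have hFrc : ContinuousOn Fr S := fun τ hτ => (hderF (N - s) τ hτ).continuousWithinAt
  have hκc : ContinuousOn κ S :=
    (hFc.div hFrc fun τ _ => (hFpos (N - s) (Nat.sub_le N s) τ).ne').rpow_const fun τ _ => Or.inr hexp0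
  -- the Lyapunov function `G` of (6.4.1)
  set G : ℝ → ℝ := fun τ => (2 * ν)⁻¹ * Real.log (F τ) + (∫ r in a..τ, κ r) -
    c * ν⁻¹ * (∫ r in a..τ, M r) - (Λ + 1) * (τ - a) with hGdef
  set G' : ℝ → ℝ := fun τ => (2 * ν)⁻¹ * (2 * v N τ / F τ) + κ τ - c * ν⁻¹ * M τ - (Λ + 1) * 1 with hG'def
  have hderG : ∀ τ ∈ S, HasDerivWithinAt G (G' τ) S τ := by
    intro τ hτ
    have h1 := ((hderF N τ hτ).log (hFpos N le_rfl τ).ne').const_mul (2 * ν)⁻¹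
    have h2 := hasDerivWithinAt_primitive hκc hτ
    have h3 := (hasDerivWithinAt_primitive hMc hτ).const_mul (c * ν⁻¹)
    have h4 := ((hasDerivWithinAt_id τ S).sub_const a).const_mul (Λ + 1)
    exact ((h1.add h2).sub h3).sub h4
  -- `G' ≤ 0`: this is (6.2.5) divided by `ν F_N`
  have hG'le : ∀ τ ∈ S, G' τ ≤ 0 * G τ := by
    intro τ hτ
    rw [zero_mul, hG'def]
    simp only [mul_one]
    have hFτ : 0 < F τ := hFpos N le_rfl τ
    have hFrτ : 0 < Fr τ := hFpos (N - s) (Nat.sub_le N s) τ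
    have h1 := hc h hab hν hΛ hcut hτ (M τ) (hM0 τ hτ) (hM τ hτ) hs1 hsN hFrτ
    rw [hhalf τ hτ] at h1
    -- `F^{1+1/s}/Fr^{1/s} = F κ`
    have hpow : F τ ^ (1 + 1 / (s : ℝ)) / Fr τ ^ (1 / (s : ℝ)) = F τ * κ τ := by
      rw [hκdef]
      simp only []
      rw [Real.div_rpow hFτ.le hFrτ.le, Real.rpow_add hFτ, Real.rpow_one, mul_div_assoc]
    have h2 : v N τ ≤ -ν * (F τ * κ τ) + (c * M τ + ν * (Λ + 1)) * F τ := by rw [← hpow]; exact h1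
    -- divide by `ν F > 0`
    have hνF : 0 < ν * F τ := mul_pos hν hFτ
    have h3 : (2 * ν)⁻¹ * (2 * v N τ / F τ) = v N τ / (ν * F τ) := by
      field_simp
    rw [h3]
    have h4 : v N τ / (ν * F τ) ≤ -κ τ + (c * ν⁻¹ * M τ + (Λ + 1)) := by
      rw [div_le_iff₀ hνF]
      have hνinv : ν⁻¹ * ν = 1 := inv_mul_cancel₀ hν.ne'
      have e : (-κ τ + (c * ν⁻¹ * M τ + (Λ + 1))) * (ν * F τ) =
          -ν * (F τ * κ τ) + (c * M τ + ν * (Λ + 1)) * F τ := by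
        calc (-κ τ + (c * ν⁻¹ * M τ + (Λ + 1))) * (ν * F τ)
            = -ν * (F τ * κ τ) + (c * M τ * (ν⁻¹ * ν) + ν * (Λ + 1)) * F τ := by ring
          _ = -ν * (F τ * κ τ) + (c * M τ + ν * (Λ + 1)) * F τ := by rw [hνinv, mul_one]
      rw [e]
      exact h2
    linarith
  -- `G` is non-increasing: `G b ≤ G a`
  have hGb := le_mul_exp_integral_of_hasDerivWithinAt_le_mul hab hderG continuousOn_const hG'le hbS
  rw [intervalIntegral.integral_const, smul_eq_mul, mul_zero, Real.exp_zero, mul_one] at hGb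
  have hGa : G a = (2 * ν)⁻¹ * Real.log (F a) := by
    rw [hGdef]
    simp only [intervalIntegral.integral_same, sub_self, mul_zero, add_zero, sub_zero]
  rw [hGa, hGdef] at hGb
  simp only [] at hGb
  have e : (2 * ν)⁻¹ * (Real.log (F b) - Real.log (F a)) =
      (2 * ν)⁻¹ * Real.log (F b) - (2 * ν)⁻¹ * Real.log (F a) := by ring
  rw [e]
  linarith

end Torus

end Literature.Analysis.FluidPDE

end
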